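import Literature.NumberTheory.Sieve.TernaryDivisorAPAuxiliaryBound
import Literature.NumberTheory.Sieve.FouvryTenenbaumDivisorAPProofs
import Literature.NumberTheory.LFunctions.KloostermanWeilReduction
import HarnessLib

/-!
# `d₃` in progressions by complete expansion: Lemma 4.13 at level `θ < 1/2` modulo Smith's `K₂` bound

Topic `Literature/NumberTheory/Sieve` (a brick of Fouvry–Tenenbaum's Lemma 4.13 = Heath-Brown's
Theorem 1; companion of `FouvryTenenbaumDivisorAPProofs.lean` (levels `θ < 4/9`, Weil only),
`ModularInverseAdditiveEnergy.lean` and `TernaryDivisorAPAuxiliaryBound.lean` (Heath-Brown §6)).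
Source: D. R. Heath-Brown, *The divisor function `d₃(n)` in arithmetic progressions*, Acta Arith. 47
(1986) 29–56 [HeathBrown1986d3]: §2 (2.3)–(2.4) (p. 34), §3 (3.1) (p. 35) and the remark p. 31.
Everything here is PROVED; the Deligne-dependent input (3.1) appears only as the explicit hypothesis
`hK2` of the last theorem (no new named fact).

## The printed statements

p. 34: "We now transform `N(U, V, W)` in three different ways … Firstly we have
`N(U,V,W) = ∑_{αβγ ≡ a} #{(u,v,w) …} = ∑ q⁻³ (∑_r ∑_u e_q(rα − ru))(∑_s ∑_v e_q(sβ − sv))(∑_t ∑_w e_q(tγ − tw))`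
(2.3) `= q⁻³ ∑_{r,s,t} (∑_{αβγ≡a} e_q(rα + sβ + tγ)) F_q(r, s, t)`, where
`F_q(r,s,t) = (∑_u e_q(−ru))(∑_v e_q(−sv))(∑_w e_q(−tw)) ≪ min(I, ‖r/q‖⁻¹) min(J, ‖s/q‖⁻¹) min(K, ‖t/q‖⁻¹)`
… The `α, β, γ` sum in (2.3) is the multiple Kloosterman sum `K₂(r, s, at; q)`, so that
(2.4) `N(U, V, W) = q⁻³ ∑_{r,s,t} K₂(r, s, at; q) F_q(r, s, t)`."
p. 35: "`K_n(a; q) = ∑*_{x (mod q), ∏xᵢ ≡ 1} e_q(a·x)` where `a, x` are `(n+1)`-dimensional vectors. … We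
only need the special case `n = 2`. By Smith ([27], Theorem 6) we have (3.1) `|K₂(a; q)| ≤ q (a, q) d₃(q)`,
where `(a; q) = (a₁, a₂, a₃; q)`."   p. 31: "the 'easy' value for `θ₃` is `1/2`".
([27] = R. A. Smith, *On n-dimensional Kloosterman sums*, J. Number Theory 11 (1979) 324–343: Theorem 6
rests on Deligne's bound for hyper-Kloosterman sums at primes and Smith's Theorems 2–3 at prime powers.)

## What is formalized

* `K2 q a₁ a₂ a₃ = ∑*_{x,y} e_q(a₁x + a₂y + a₃x̄ȳ)` (`= K₂(a; q)` with `x₃ = x̄ȳ`), `d3 q = ∑_{d∣q} d(d) = d₃(q)`,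
  `d3_le : d₃(q) ≤ d(q)²`;
* `sum_eq_completion` (completing a sum over `u ∈ B` modulo `s`) and `sum_units_stdAddChar_inv_inv_eq`:
  `∑_{u∈B₁*, v∈B₂*} e_s(cūv̄) = s⁻² ∑_{r,σ} G₁(r)G₂(σ) K₂(−r, −σ, c; s)` — (2.3)–(2.4) for two variables
  (the third, `w`, is expanded by `sum_gAP_three_eq_fourier`, whose zero frequency vanishes for `g_s`);
* `abs_sum3_gAP_le_of_K2`: if `|K₂(c₁,c₂,c₃; s)| ≤ s (c₃, s) T` then for `(a,s) = (D,s) = 1` and three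
  classes `Bᵢ` of intervals `mod D`,
  `|∑_{B₁×B₂×B₃} g_s(uvw; a)| ≤ d(s)(1+log s)·(T(#B₁ + s(1+log s))(#B₂ + s(1+log s))/s + #B₁#B₂/φ(s))`;
* **`FouvryTenenbaum2021_lemma413_of_K2_bound`**: assuming (3.1) for all moduli (hypothesis `hK2`),
  the statement of `FouvryTenenbaum2021_lemma413` holds with `x^{1/2+1/85}` replaced by `x^θ` for
  every `θ < 1/2` (`δ = min(1/24, 3(1 − 2θ₁)/16)`, `θ₁ = max(θ, 1/4)`, `C₀ = 0`).
  Together with `FouvryTenenbaum2021_lemma413_of_lt` (θ < 4/9 unconditionally) this locates the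
  remaining difficulty of Lemma 4.13 exactly: Deligne's bound (level `1/2`) and Heath-Brown's §§3–4, 7
  (from `1/2` to `1/2 + 1/85`).
* `d3_mul_of_coprime` (`d₃ = σ₀ * ζ` is multiplicative), `K2_mul_of_coprime` (twisted multiplicativity
  `K₂(a; c₁c₂) = K₂(c̄₂a; c₁) K₂(c̄₁a; c₂)`, cf. (3.4) and Hooley's product formula), `K2_bound_of_primePow`
  ((3.1) for all `q` from (3.1) at prime powers) and `FouvryTenenbaum2021_lemma413_of_K2_bound_primePow`
  (the level-`1/2` statement assuming (3.1) at prime-power moduli only: Deligne at `p`, Smith's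
  Theorems 2–3 at `p^α`, `α ≥ 2`);
* at a prime `p`: `K2_third_zero`, `K2_first_zero`, `K2_second_zero` (the degenerate sums are
  `c_p(a₁)c_p(a₂)`, `−c_p(a₂)`, `−c_p(a₁)`; cf. (3.6)–(3.8)), `d3_prime`, and
  `K2_bound_prime_of_nondegenerate`: (3.1) at `p` follows from `|K₂(a; p)| ≤ 3p` for `p ∤ a₁a₂a₃`
  (Deligne's bound proper).

## References

* D. R. Heath-Brown, Acta Arith. 47 (1986) 29–56, §2 (2.3)–(2.4), §3 (3.1), p. 31. [HeathBrown1986d3]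
* R. A. Smith, *On n-dimensional Kloosterman sums*, J. Number Theory 11 (1979) 324–343, Thms 2, 3, 6.
* É. Fouvry, G. Tenenbaum, *Multiplicative functions in large arithmetic progressions and
  applications*, Trans. Amer. Math. Soc. (2021), doi:10.1090/tran/8442, Lemma 4.13. [FouvryTenenbaum2021]
-/

open Finset

noncomputable section

namespace Literature.NumberTheory.Sieve

namespace HeathBrown1986

open Literature.NumberTheory.LFunctions (kloostermanSum kloostermanSum_comm)
open Literature.NumberTheory.LFunctions.MatomakiMerikoski (norm_kloostermanSum_zero_left_le)
open Literature.NumberTheory.Sieve.Vinogradov (distInt distInt_nonneg)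
open FouvryTenenbaum2021 (gAP lemma412_sum_gAP_eq_fourier lemma412_kloostermanSum_zero_zero
  lemma412_sum_filter_eq_sum_Ioc lemma412_norm_sum_Ioc_stdAddChar_le lemma412_gcd_val_mul_of_isUnit
  lemma412_sum_gcd_div_distInt_le)

/-! ### The hyper-Kloosterman sum `K₂` -/

/-- Smith's / Heath-Brown's multiple Kloosterman sum `K₂(a; q) = ∑*_{x₁x₂x₃ ≡ 1 (q)} e_q(a·x)`
`= ∑*_{x, y} e_q(a₁x + a₂y + a₃ x̄ȳ)` (the `*` restricting to units).
[cite: HeathBrown1986d3, §3 (definition of `K_n(a; q)`, `n = 2`)] -/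
def K2 (q : ℕ) [NeZero q] (a₁ a₂ a₃ : ZMod q) : ℂ := by
  classical
  exact ∑ x : ZMod q, ∑ y : ZMod q,
    if IsUnit x ∧ IsUnit y then (ZMod.stdAddChar (a₁ * x + a₂ * y + a₃ * (x⁻¹ * y⁻¹)) : ℂ) else 0

/-- `d₃(q) = #{(d₁, d₂, d₃) : d₁d₂d₃ = q} = ∑_{d ∣ q} d(d)`. [folklore] -/
def d3 (q : ℕ) : ℕ := ∑ d ∈ Nat.divisors q, (Nat.divisors d).card

/-- `d₃(q) ≤ d(q)²`. [folklore] -/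
theorem d3_le (q : ℕ) : d3 q ≤ (Nat.divisors q).card ^ 2 := by
  unfold d3
  calc ∑ d ∈ Nat.divisors q, (Nat.divisors d).card ≤ ∑ _d ∈ Nat.divisors q, (Nat.divisors q).card := by
        refine Finset.sum_le_sum fun d hd => Finset.card_le_card ?_
        exact Nat.divisors_subset_of_dvd (Nat.mem_divisors.mp hd).2 (Nat.mem_divisors.mp hd).1
    _ = (Nat.divisors q).card ^ 2 := by rw [Finset.sum_const, smul_eq_mul, sq]

/-! ### Completion of a sum over residues -/

/-- **Completion**: `∑_{u ∈ B} f(u mod s) = s⁻¹ ∑_r (∑_{u ∈ B} e_s(ru)) (∑_x f(x) e_s(−rx))`. [folklore] -/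
theorem sum_eq_completion (s : ℕ) [NeZero s] (B : Finset ℕ) (f : ZMod s → ℂ) :
    ∑ u ∈ B, f (u : ZMod s) =
      (s : ℂ)⁻¹ * ∑ r : ZMod s, (∑ u ∈ B, (ZMod.stdAddChar (r * (u : ZMod s)) : ℂ)) *
        ∑ x : ZMod s, f x * (ZMod.stdAddChar (-(r * x)) : ℂ) := by
  classical
  have hs : 0 < s := Nat.pos_of_ne_zero (NeZero.ne s)
  have hsC : (s : ℂ) ≠ 0 := Nat.cast_ne_zero.mpr hs.ne'
  set ψ : AddChar (ZMod s) ℂ := ZMod.stdAddChar with hψ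
  have horth : ∀ z : ZMod s, ∑ r : ZMod s, (ψ (r * z) : ℂ) = if z = 0 then (s : ℂ) else 0 := by
    intro z
    have := sum_stdAddChar_mul s z
    rw [hψ, ← this]
    exact Finset.sum_congr rfl fun r _ => by rw [mul_comm]
  -- expand the right-hand side to `∑_u ∑_x f x (∑_r ψ(r(u-x)))`
  have e1 : ∑ r : ZMod s, (∑ u ∈ B, (ψ (r * (u : ZMod s)) : ℂ)) * ∑ x : ZMod s, f x * (ψ (-(r * x)) : ℂ) =
      ∑ u ∈ B, ∑ x : ZMod s, f x * ∑ r : ZMod s, (ψ (r * ((u : ZMod s) - x)) : ℂ) := by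
    have : ∀ r : ZMod s, (∑ u ∈ B, (ψ (r * (u : ZMod s)) : ℂ)) * ∑ x : ZMod s, f x * (ψ (-(r * x)) : ℂ) =
        ∑ u ∈ B, ∑ x : ZMod s, f x * (ψ (r * ((u : ZMod s) - x)) : ℂ) := by
      intro r
      rw [Finset.sum_mul]
      refine Finset.sum_congr rfl fun u _ => ?_
      rw [Finset.mul_sum]
      refine Finset.sum_congr rfl fun x _ => ?_
      rw [mul_sub, sub_eq_add_neg, AddChar.map_add_eq_mul]
      ring
    rw [Finset.sum_congr rfl (fun r _ => this r), Finset.sum_comm]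
    refine Finset.sum_congr rfl fun u _ => ?_
    rw [Finset.sum_comm]
    refine Finset.sum_congr rfl fun x _ => ?_
    rw [Finset.mul_sum]
  rw [e1]
  -- orthogonality
  have e2 : ∀ u ∈ B, ∑ x : ZMod s, f x * ∑ r : ZMod s, (ψ (r * ((u : ZMod s) - x)) : ℂ) = (s : ℂ) * f (u : ZMod s) := by
    intro u _
    have : ∀ x : ZMod s, f x * ∑ r : ZMod s, (ψ (r * ((u : ZMod s) - x)) : ℂ) =
        if (u : ZMod s) = x then (s : ℂ) * f x else 0 := by
      intro x
      rw [horth]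
      split_ifs with h1 h2 h2
      · ring
      · exact absurd (sub_eq_zero.mp h1) h2
      · exact absurd (sub_eq_zero.mpr h2) h1
      · ring
    rw [Finset.sum_congr rfl (fun x _ => this x), Finset.sum_ite_eq Finset.univ (u : ZMod s),
      if_pos (Finset.mem_univ _)]
  rw [Finset.sum_congr rfl e2, ← Finset.mul_sum, ← mul_assoc, inv_mul_cancel₀ hsC, one_mul]

/-- **Double completion** ((2.3)–(2.4) for two of the variables): for `c ∈ ℤ/sℤ`,
`∑_{u ∈ B₁*, v ∈ B₂*} e_s(c ū v̄) = s⁻² ∑_{r, σ} G₁(r) G₂(σ) K₂(−r, −σ, c; s)`,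
`Gᵢ(r) = ∑_{m ∈ Bᵢ} e_s(rm)`. [cite: HeathBrown1986d3, §2 (2.3)–(2.4)] -/
theorem sum_units_stdAddChar_inv_inv_eq (s : ℕ) [NeZero s] (c : ZMod s) (B₁ B₂ : Finset ℕ) :
    ∑ u ∈ unitsIn s B₁, ∑ v ∈ unitsIn s B₂,
        (ZMod.stdAddChar (c * (((u : ZMod s))⁻¹ * ((v : ZMod s))⁻¹)) : ℂ) =
      (s : ℂ)⁻¹ * ∑ r : ZMod s, (∑ u ∈ B₁, (ZMod.stdAddChar (r * (u : ZMod s)) : ℂ)) *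
        ((s : ℂ)⁻¹ * ∑ σ : ZMod s, (∑ v ∈ B₂, (ZMod.stdAddChar (σ * (v : ZMod s)) : ℂ)) *
          K2 s (-r) (-σ) c) := by
  classical
  set ψ : AddChar (ZMod s) ℂ := ZMod.stdAddChar with hψ
  have hU : ∀ B : Finset ℕ, unitsIn s B = B.filter (fun u : ℕ => IsUnit (u : ZMod s)) := by
    intro B; ext u; rw [Finset.mem_filter, mem_unitsIn, ZMod.isUnit_iff_coprime]
  -- the inner (`v`) completion, for a fixed residue `x`
  set f₂ : ZMod s → ZMod s → ℂ := fun x y => if IsUnit y then (ψ (c * (x⁻¹ * y⁻¹)) : ℂ) else 0 with hf₂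
  have hinner : ∀ x : ZMod s, ∑ v ∈ unitsIn s B₂, (ψ (c * (x⁻¹ * ((v : ZMod s))⁻¹)) : ℂ) =
      (s : ℂ)⁻¹ * ∑ σ : ZMod s, (∑ v ∈ B₂, (ψ (σ * (v : ZMod s)) : ℂ)) *
        ∑ y : ZMod s, f₂ x y * (ψ (-(σ * y)) : ℂ) := by
    intro x
    rw [hU B₂, Finset.sum_filter]
    exact sum_eq_completion s B₂ (f₂ x)
  -- the outer (`u`) completion
  set f₁ : ZMod s → ℂ := fun x => if IsUnit x then
      (s : ℂ)⁻¹ * ∑ σ : ZMod s, (∑ v ∈ B₂, (ψ (σ * (v : ZMod s)) : ℂ)) *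
        ∑ y : ZMod s, f₂ x y * (ψ (-(σ * y)) : ℂ) else 0 with hf₁
  have houter : ∑ u ∈ unitsIn s B₁, ∑ v ∈ unitsIn s B₂,
      (ψ (c * (((u : ZMod s))⁻¹ * ((v : ZMod s))⁻¹)) : ℂ) = ∑ u ∈ B₁, f₁ (u : ZMod s) := by
    rw [hU B₁, Finset.sum_filter]
    refine Finset.sum_congr rfl fun u _ => ?_
    simp only [hf₁]
    split_ifs with hu
    · rw [← hinner, hU B₂]
    · rfl
  rw [houter, sum_eq_completion s B₁ f₁]
  congr 1
  refine Finset.sum_congr rfl fun r _ => ?_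
  congr 1
  -- `∑_x f₁ x ψ(-rx) = s⁻¹ ∑_σ G₂(σ) K2(-r,-σ,c)`
  simp only [hf₁]
  unfold K2
  rw [Finset.mul_sum]
  -- rewrite the `σ`-side as a sum over `x`
  have e : ∀ σ : ZMod s, (s : ℂ)⁻¹ * ((∑ v ∈ B₂, (ψ (σ * (v : ZMod s)) : ℂ)) *
      ∑ x : ZMod s, ∑ y : ZMod s,
        (if IsUnit x ∧ IsUnit y then (ZMod.stdAddChar (-r * x + -σ * y + c * (x⁻¹ * y⁻¹)) : ℂ) else 0)) =
      ∑ x : ZMod s, (if IsUnit x then (s : ℂ)⁻¹ * ((∑ v ∈ B₂, (ψ (σ * (v : ZMod s)) : ℂ)) *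
        ∑ y : ZMod s, f₂ x y * (ψ (-(σ * y)) : ℂ)) else 0) * (ψ (-(r * x)) : ℂ) := by
    intro σ
    rw [Finset.mul_sum, Finset.mul_sum]
    refine Finset.sum_congr rfl fun x _ => ?_
    by_cases hx : IsUnit x
    · rw [if_pos hx]
      have hy : ∑ y : ZMod s,
          (if IsUnit x ∧ IsUnit y then (ZMod.stdAddChar (-r * x + -σ * y + c * (x⁻¹ * y⁻¹)) : ℂ) else 0) =
          (∑ y : ZMod s, f₂ x y * (ψ (-(σ * y)) : ℂ)) * (ψ (-(r * x)) : ℂ) := by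
        rw [Finset.sum_mul]
        refine Finset.sum_congr rfl fun y _ => ?_
        simp only [hf₂]
        by_cases hy : IsUnit y
        · rw [if_pos ⟨hx, hy⟩, if_pos hy, hψ, ← AddChar.map_add_eq_mul, ← AddChar.map_add_eq_mul]
          congr 1; ring
        · rw [if_neg (fun h => hy h.2), if_neg hy]; ring
      rw [hy]; ring
    · rw [if_neg hx, zero_mul]
      have : ∑ y : ZMod s,
          (if IsUnit x ∧ IsUnit y then (ZMod.stdAddChar (-r * x + -σ * y + c * (x⁻¹ * y⁻¹)) : ℂ) else 0) = 0 :=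
        Finset.sum_eq_zero fun y _ => by rw [if_neg (fun h => hx h.1)]
      rw [this]; ring
  rw [Finset.sum_congr rfl (fun σ _ => e σ), Finset.sum_comm]
  refine Finset.sum_congr rfl fun x _ => ?_
  by_cases hx : IsUnit x
  · simp only [if_pos hx]
    rw [Finset.mul_sum, Finset.sum_mul]
  · simp only [if_neg hx, zero_mul, Finset.sum_const_zero]

/-! ### Bounds -/

/-- `∑_r |G_B(r)| ≤ #B + s(1 + log s)` for a class `mod D` of an interval, `(D, s) = 1`. [folklore] -/
theorem sum_norm_boxSum_le {s D : ℕ} [NeZero s] (hD : 0 < D) (hDs : D.Coprime s) (L R : ℕ) (t₀ : ℤ) :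
    ∑ r : ZMod s, ‖∑ m ∈ (Finset.Ioc L R).filter (fun m : ℕ => (m : ZMod D) = (t₀ : ZMod D)),
        (ZMod.stdAddChar (r * (m : ZMod s)) : ℂ)‖ ≤
      ((Finset.Ioc L R).filter (fun m : ℕ => (m : ZMod D) = (t₀ : ZMod D))).card + (s : ℝ) * (1 + Real.log s) := by
  classical
  set box := (Finset.Ioc L R).filter (fun m : ℕ => (m : ZMod D) = (t₀ : ZMod D)) with hbox
  set Dz : ZMod s := (D : ZMod s) with hDz
  have hDu : IsUnit Dz := (ZMod.isUnit_iff_coprime D s).mpr hDs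
  set Φ : ZMod s → ℝ := fun w => 1 / (2 * distInt (((w.val : ℕ) : ℝ) / s)) with hΦ
  have h0 : ‖∑ m ∈ box, (ZMod.stdAddChar ((0 : ZMod s) * (m : ZMod s)) : ℂ)‖ ≤ box.card := by
    calc ‖∑ m ∈ box, (ZMod.stdAddChar ((0 : ZMod s) * (m : ZMod s)) : ℂ)‖
        ≤ ∑ m ∈ box, ‖(ZMod.stdAddChar ((0 : ZMod s) * (m : ZMod s)) : ℂ)‖ := norm_sum_le _ _
      _ = box.card := by
          rw [Finset.sum_congr rfl (fun m _ => by rw [ZMod.stdAddChar_apply, Circle.norm_coe]),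
            Finset.sum_const, nsmul_eq_mul, mul_one]
  rw [← Finset.sum_erase_add _ _ (Finset.mem_univ (0 : ZMod s))]
  rw [add_comm]
  apply add_le_add h0
  calc ∑ r ∈ (Finset.univ : Finset (ZMod s)).erase 0, ‖∑ m ∈ box, (ZMod.stdAddChar (r * (m : ZMod s)) : ℂ)‖
      ≤ ∑ r ∈ (Finset.univ : Finset (ZMod s)).erase 0, Φ (r * Dz) :=
        Finset.sum_le_sum fun r hr => norm_sum_box_stdAddChar_le hD hDs L R t₀ (Finset.ne_of_mem_erase hr)
    _ = ∑ w ∈ (Finset.univ : Finset (ZMod s)).erase 0, Φ w := by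
        refine Finset.sum_nbij' (fun t => t * Dz) (fun w => w * Dz⁻¹) (fun t ht => ?_)
          (fun w hw => ?_) (fun t _ => ?_) (fun w _ => ?_) (fun t _ => rfl)
        · rw [Finset.mem_erase] at ht ⊢
          refine ⟨fun h0 => ht.1 ?_, Finset.mem_univ _⟩
          have : t * Dz * Dz⁻¹ = 0 := by rw [h0, zero_mul]
          rwa [mul_assoc, ZMod.mul_inv_of_unit _ hDu, mul_one] at this
        · rw [Finset.mem_erase] at hw ⊢
          refine ⟨fun h0 => hw.1 ?_, Finset.mem_univ _⟩
          have : w * Dz⁻¹ * Dz = 0 := by rw [h0, zero_mul]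
          rwa [mul_assoc, mul_comm (Dz⁻¹), ZMod.mul_inv_of_unit _ hDu, mul_one] at this
        · rw [mul_assoc, ZMod.mul_inv_of_unit _ hDu, mul_one]
        · rw [mul_assoc, mul_comm (Dz⁻¹), ZMod.mul_inv_of_unit _ hDu, mul_one]
    _ ≤ (s : ℝ) * (1 + Real.log s) := sum_inv_distInt_zmod_le s

/-- The completed `u, v` sum under a `K₂` bound `|K₂(c₁, c₂, c; s)| ≤ s (c, s) T`:
`|∑_{u ∈ B₁*, v ∈ B₂*} e_s(c ū v̄)| ≤ s⁻¹ (c, s) T (∑_r |G₁(r)|)(∑_σ |G₂(σ)|)`. [folklore] -/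
theorem norm_sum_units_inv_inv_le {s : ℕ} [NeZero s] {T : ℝ}
    (hK : ∀ c₁ c₂ c₃ : ZMod s, ‖K2 s c₁ c₂ c₃‖ ≤ s * (Nat.gcd c₃.val s : ℝ) * T)
    (c : ZMod s) (B₁ B₂ : Finset ℕ) :
    ‖∑ u ∈ unitsIn s B₁, ∑ v ∈ unitsIn s B₂,
        (ZMod.stdAddChar (c * (((u : ZMod s))⁻¹ * ((v : ZMod s))⁻¹)) : ℂ)‖ ≤
      (s : ℝ)⁻¹ * (Nat.gcd c.val s : ℝ) * T *
        ((∑ r : ZMod s, ‖∑ u ∈ B₁, (ZMod.stdAddChar (r * (u : ZMod s)) : ℂ)‖) *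
          ∑ σ : ZMod s, ‖∑ v ∈ B₂, (ZMod.stdAddChar (σ * (v : ZMod s)) : ℂ)‖) := by
  have hs : 0 < s := Nat.pos_of_ne_zero (NeZero.ne s)
  have hsR : (0 : ℝ) < s := by exact_mod_cast hs
  set G₁ : ZMod s → ℂ := fun r => ∑ u ∈ B₁, (ZMod.stdAddChar (r * (u : ZMod s)) : ℂ) with hG₁
  set G₂ : ZMod s → ℂ := fun σ => ∑ v ∈ B₂, (ZMod.stdAddChar (σ * (v : ZMod s)) : ℂ) with hG₂
  set g : ℝ := (Nat.gcd c.val s : ℝ) with hg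
  rw [sum_units_stdAddChar_inv_inv_eq]
  rw [norm_mul, norm_inv, Complex.norm_natCast]
  have hinner : ∀ r : ZMod s, ‖(s : ℂ)⁻¹ * ∑ σ : ZMod s, G₂ σ * K2 s (-r) (-σ) c‖ ≤
      (s : ℝ)⁻¹ * ((s : ℝ) * g * T) * ∑ σ : ZMod s, ‖G₂ σ‖ := by
    intro r
    rw [norm_mul, norm_inv, Complex.norm_natCast, mul_assoc]
    apply mul_le_mul_of_nonneg_left _ (by positivity)
    rw [Finset.mul_sum]
    refine (norm_sum_le _ _).trans (Finset.sum_le_sum fun σ _ => ?_)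
    rw [norm_mul, mul_comm ((s : ℝ) * g * T)]
    exact mul_le_mul_of_nonneg_left (hK _ _ _) (norm_nonneg _)
  calc (s : ℝ)⁻¹ * ‖∑ r : ZMod s, G₁ r * ((s : ℂ)⁻¹ * ∑ σ : ZMod s, G₂ σ * K2 s (-r) (-σ) c)‖
      ≤ (s : ℝ)⁻¹ * ∑ r : ZMod s, ‖G₁ r‖ * ((s : ℝ)⁻¹ * ((s : ℝ) * g * T) * ∑ σ : ZMod s, ‖G₂ σ‖) := by
        apply mul_le_mul_of_nonneg_left _ (by positivity)
        refine (norm_sum_le _ _).trans (Finset.sum_le_sum fun r _ => ?_)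
        rw [norm_mul]
        exact mul_le_mul_of_nonneg_left (hinner r) (norm_nonneg _)
    _ = (s : ℝ)⁻¹ * g * T * ((∑ r : ZMod s, ‖G₁ r‖) * ∑ σ : ZMod s, ‖G₂ σ‖) := by
        rw [← Finset.sum_mul]; field_simp

/-- The `u,v`-sum `E(t)` at a nonzero frequency, double-sum form:
`‖E(t)‖ ≤ ‖∑_{u ∈ B₁*} ∑_{v ∈ B₂*} e_s((−tα) ū v̄)‖ + #B₁* #B₂* (t, s)/φ(s)`. [folklore] -/
theorem norm_E_le' {s : ℕ} [NeZero s] (α : ZMod s) (B₁ B₂ : Finset ℕ) (t : ZMod s) :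
    ‖∑ u ∈ B₁, ∑ v ∈ B₂, (if IsUnit ((u * v : ℕ) : ZMod s) then
        ((ZMod.stdAddChar (-(t * (α * ((u * v : ℕ) : ZMod s)⁻¹))) : ℂ) -
          kloostermanSum s (-t) 0 / (Nat.totient s : ℂ)) else 0)‖ ≤
      ‖∑ u ∈ unitsIn s B₁, ∑ v ∈ unitsIn s B₂,
          (ZMod.stdAddChar ((-t * α) * (((u : ZMod s))⁻¹ * ((v : ZMod s))⁻¹)) : ℂ)‖ +
        (unitsIn s B₁).card * (unitsIn s B₂).card * ((Nat.gcd t.val s : ℝ) / Nat.totient s) := by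
  classical
  have hs : 0 < s := Nat.pos_of_ne_zero (NeZero.ne s)
  have hφ0 : (0 : ℝ) < Nat.totient s := by exact_mod_cast Nat.totient_pos.mpr hs
  set ψ : AddChar (ZMod s) ℂ := ZMod.stdAddChar with hψ
  set K : ℂ := kloostermanSum s (-t) 0 / (Nat.totient s : ℂ) with hK
  have hU : unitsIn s B₁ = B₁.filter (fun u : ℕ => IsUnit (u : ZMod s)) := by
    ext u; rw [Finset.mem_filter, mem_unitsIn, ZMod.isUnit_iff_coprime]
  have hV : unitsIn s B₂ = B₂.filter (fun v : ℕ => IsUnit (v : ZMod s)) := by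
    ext v; rw [Finset.mem_filter, mem_unitsIn, ZMod.isUnit_iff_coprime]
  have hsum : ∑ u ∈ B₁, ∑ v ∈ B₂, (if IsUnit ((u * v : ℕ) : ZMod s) then
      ((ψ (-(t * (α * ((u * v : ℕ) : ZMod s)⁻¹))) : ℂ) - K) else 0) =
      ∑ u ∈ unitsIn s B₁, (∑ v ∈ unitsIn s B₂,
        (ψ ((-t * α) * (((u : ZMod s))⁻¹ * ((v : ZMod s))⁻¹)) : ℂ) - (unitsIn s B₂).card * K) := by
    rw [hU, Finset.sum_filter]
    refine Finset.sum_congr rfl fun u _ => ?_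
    split_ifs with hu
    · rw [hV, Finset.sum_filter]
      have hcard : ((B₂.filter (fun v : ℕ => IsUnit (v : ZMod s))).card : ℂ) * K =
          ∑ v ∈ B₂, (if IsUnit (v : ZMod s) then K else 0) := by
        rw [Finset.sum_ite, Finset.sum_const_zero, add_zero, Finset.sum_const, nsmul_eq_mul]
      rw [hcard, ← Finset.sum_sub_distrib]
      refine Finset.sum_congr rfl fun v _ => ?_
      by_cases hv : IsUnit (v : ZMod s)
      · have huv : IsUnit ((u * v : ℕ) : ZMod s) := by rw [Nat.cast_mul]; exact hu.mul hv
        rw [if_pos huv, if_pos hv, if_pos hv]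
        congr 2
        rw [Nat.cast_mul, mul_inv_of_isUnit hu hv]; ring
      · have huv : ¬ IsUnit ((u * v : ℕ) : ZMod s) := by
          rw [Nat.cast_mul]; exact fun h => hv (IsUnit.mul_iff.mp h).2
        rw [if_neg huv, if_neg hv, if_neg hv, sub_zero]
    · refine Finset.sum_eq_zero fun v _ => ?_
      have huv : ¬ IsUnit ((u * v : ℕ) : ZMod s) := by
        rw [Nat.cast_mul]; exact fun h => hu (IsUnit.mul_iff.mp h).1
      rw [if_neg huv]
  rw [hsum, Finset.sum_sub_distrib, Finset.sum_const, nsmul_eq_mul]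
  have hKn : ‖K‖ ≤ (Nat.gcd t.val s : ℝ) / Nat.totient s := by
    rw [hK, norm_div, Complex.norm_natCast]
    apply div_le_div_of_nonneg_right _ hφ0.le
    rw [kloostermanSum_comm]
    refine (norm_kloostermanSum_zero_left_le s (-t)).trans ?_
    rw [show (-t) = t * (-1) by ring, lemma412_gcd_val_mul_of_isUnit t isUnit_one.neg]
  calc ‖∑ u ∈ unitsIn s B₁, ∑ v ∈ unitsIn s B₂, (ψ ((-t * α) * (((u : ZMod s))⁻¹ * ((v : ZMod s))⁻¹)) : ℂ) -
          ((unitsIn s B₁).card : ℂ) * (((unitsIn s B₂).card : ℂ) * K)‖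
      ≤ ‖∑ u ∈ unitsIn s B₁, ∑ v ∈ unitsIn s B₂, (ψ ((-t * α) * (((u : ZMod s))⁻¹ * ((v : ZMod s))⁻¹)) : ℂ)‖ +
          ‖((unitsIn s B₁).card : ℂ) * (((unitsIn s B₂).card : ℂ) * K)‖ := norm_sub_le _ _
    _ ≤ _ := by
        apply add_le_add le_rfl
        rw [norm_mul, norm_mul, Complex.norm_natCast, Complex.norm_natCast, mul_assoc]
        apply mul_le_mul_of_nonneg_left _ (Nat.cast_nonneg _)
        exact mul_le_mul_of_nonneg_left hKn (Nat.cast_nonneg _)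

/-! ### The complete-expansion bound for three boxes -/

set_option maxHeartbeats 800000 in
/-- **The "complete all variables" bound** (Heath-Brown (2.3)–(2.4) with a pointwise `K₂` estimate —
"the 'easy' value for `θ₃` is `1/2`", p. 31): if `|K₂(c₁, c₂, c₃; s)| ≤ s (c₃, s) T` for all
`c₁, c₂, c₃`, then for `(a, s) = 1`, `(D, s) = 1` and any three classes of intervals `B₁, B₂, B₃`
(`mod D`), `|∑_{B₁×B₂×B₃} g_s(uvw; a)| ≤ d(s)(1 + log s)·(T (#B₁ + s(1+log s))(#B₂ + s(1+log s))/s`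
`+ #B₁ #B₂/φ(s))` (expand in `w`, complete `u` and `v`; the zero frequency vanishes; Ramanujan sums
`|c_s(t)| ≤ (t, s)`; `∑_{t≠0} (t,s)/(2‖t/s‖) ≤ d(s)s(1 + log s)`). [cite: HeathBrown1986d3, §2 (2.3)–(2.4) & §3 (3.1)] -/
theorem abs_sum3_gAP_le_of_K2 {s D : ℕ} [NeZero s] (hD : 0 < D) (hDs : D.Coprime s) {a : ℤ}
    (ha : IsUnit (a : ZMod s)) {T : ℝ} (hT : 0 ≤ T)
    (hK : ∀ c₁ c₂ c₃ : ZMod s, ‖K2 s c₁ c₂ c₃‖ ≤ s * (Nat.gcd c₃.val s : ℝ) * T)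
    (L₁ R₁ L₂ R₂ L₃ R₃ : ℕ) (t₁ t₂ t₃ : ℤ) :
    |∑ u ∈ (Finset.Ioc L₁ R₁).filter (fun m : ℕ => (m : ZMod D) = (t₁ : ZMod D)),
        ∑ v ∈ (Finset.Ioc L₂ R₂).filter (fun m : ℕ => (m : ZMod D) = (t₂ : ZMod D)),
          ∑ w ∈ (Finset.Ioc L₃ R₃).filter (fun m : ℕ => (m : ZMod D) = (t₃ : ZMod D)),
            gAP s a (u * v * w)| ≤
      (Nat.divisors s).card * (1 + Real.log s) *
        (T * (((((Finset.Ioc L₁ R₁).filter (fun m : ℕ => (m : ZMod D) = (t₁ : ZMod D))).card : ℝ)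
                + (s : ℝ) * (1 + Real.log s)) *
              ((((Finset.Ioc L₂ R₂).filter (fun m : ℕ => (m : ZMod D) = (t₂ : ZMod D))).card : ℝ)
                + (s : ℝ) * (1 + Real.log s))) / s +
          (((Finset.Ioc L₁ R₁).filter (fun m : ℕ => (m : ZMod D) = (t₁ : ZMod D))).card : ℝ) *
            (((Finset.Ioc L₂ R₂).filter (fun m : ℕ => (m : ZMod D) = (t₂ : ZMod D))).card : ℝ) /
            Nat.totient s) := by
  classical
  have hs : 0 < s := Nat.pos_of_ne_zero (NeZero.ne s)
  have hsR : (0 : ℝ) < s := by exact_mod_cast hs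
  have hs1 : (1 : ℝ) ≤ s := by exact_mod_cast hs
  have hφ0 : (0 : ℝ) < Nat.totient s := by exact_mod_cast Nat.totient_pos.mpr hs
  have hlog : 0 ≤ 1 + Real.log s := by have := Real.log_nonneg hs1; linarith
  haveI : NeZero D := ⟨hD.ne'⟩
  set box₁ := (Finset.Ioc L₁ R₁).filter (fun m : ℕ => (m : ZMod D) = (t₁ : ZMod D)) with hbox₁
  set box₂ := (Finset.Ioc L₂ R₂).filter (fun m : ℕ => (m : ZMod D) = (t₂ : ZMod D)) with hbox₂
  set box₃ := (Finset.Ioc L₃ R₃).filter (fun m : ℕ => (m : ZMod D) = (t₃ : ZMod D)) with hbox₃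
  set ψ : AddChar (ZMod s) ℂ := ZMod.stdAddChar with hψ
  set α : ZMod s := (a : ZMod s) with hα
  set Dz : ZMod s := (D : ZMod s) with hDz
  have hDu : IsUnit Dz := (ZMod.isUnit_iff_coprime D s).mpr hDs
  set Ub := unitsIn s box₁ with hUb
  set Vb := unitsIn s box₂ with hVb
  set τ : ℝ := ((Nat.divisors s).card : ℝ) with hτ
  set Ls : ℝ := (s : ℝ) * (1 + Real.log s) with hLs
  set X₁ : ℝ := (box₁.card : ℝ) + Ls with hX₁
  set X₂ : ℝ := (box₂.card : ℝ) + Ls with hX₂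
  set E : ZMod s → ℂ := fun t => ∑ u ∈ box₁, ∑ v ∈ box₂, (if IsUnit ((u * v : ℕ) : ZMod s) then
      ((ψ (-(t * (α * ((u * v : ℕ) : ZMod s)⁻¹))) : ℂ) - kloostermanSum s (-t) 0 / (Nat.totient s : ℂ))
        else 0) with hE
  set F : ZMod s → ℂ := fun t => ∑ w ∈ box₃, (ψ (t * (w : ZMod s)) : ℂ) with hF
  set Φ : ZMod s → ℝ := fun w => 1 / (2 * distInt (((w.val : ℕ) : ℝ) / s)) with hΦ
  have hΦ0 : ∀ w, 0 ≤ Φ w := fun w => by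
    simp only [hΦ]; exact div_nonneg zero_le_one (mul_nonneg zero_le_two (distInt_nonneg _))
  -- Fourier identity and zero frequency
  have hbox₁1 : ∀ u ∈ box₁, 1 ≤ u := fun u hu => by
    have := (Finset.mem_Ioc.mp (Finset.mem_filter.mp hu).1).1; omega
  have hid : (((∑ u ∈ box₁, ∑ v ∈ box₂, ∑ w ∈ box₃, gAP s a (u * v * w) : ℝ)) : ℂ) =
      (s : ℂ)⁻¹ * ∑ t : ZMod s, E t * F t := sum_gAP_three_eq_fourier ha box₁ box₂ box₃ hbox₁1
  have hφC : (Nat.totient s : ℂ) ≠ 0 := Nat.cast_ne_zero.mpr (Nat.totient_pos.mpr hs).ne'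
  have hE0 : E 0 = 0 := by
    simp only [hE]
    refine Finset.sum_eq_zero fun u _ => Finset.sum_eq_zero fun v _ => ?_
    split_ifs
    · simp [lemma412_kloostermanSum_zero_zero, hφC]
    · rfl
  -- sizes of the completed sums
  have hG₁ : ∑ r : ZMod s, ‖∑ u ∈ box₁, (ZMod.stdAddChar (r * (u : ZMod s)) : ℂ)‖ ≤ X₁ :=
    sum_norm_boxSum_le hD hDs L₁ R₁ t₁
  have hG₂ : ∑ σ : ZMod s, ‖∑ v ∈ box₂, (ZMod.stdAddChar (σ * (v : ZMod s)) : ℂ)‖ ≤ X₂ :=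
    sum_norm_boxSum_le hD hDs L₂ R₂ t₂
  have hX₁0 : 0 ≤ X₁ := by positivity
  have hX₂0 : 0 ≤ X₂ := by positivity
  -- `‖E t‖ ≤ (t,s) W₀` with `W₀ = T X₁ X₂ / s + #B₁ #B₂ / φ(s)`
  set W₀ : ℝ := T * (X₁ * X₂) / s + (box₁.card : ℝ) * box₂.card / Nat.totient s with hW₀
  have hW₀0 : 0 ≤ W₀ := by positivity
  have hgcd1 : ∀ t : ZMod s, (1 : ℝ) ≤ Nat.gcd t.val s := fun t => by
    exact_mod_cast Nat.gcd_pos_of_pos_right _ hs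
  have hUbc : (Ub.card : ℝ) ≤ box₁.card := by exact_mod_cast card_unitsIn_le box₁
  have hVbc : (Vb.card : ℝ) ≤ box₂.card := by exact_mod_cast card_unitsIn_le box₂
  have hEt : ∀ t : ZMod s, ‖E t‖ ≤ (Nat.gcd t.val s : ℝ) * W₀ := by
    intro t
    set g : ℝ := (Nat.gcd t.val s : ℝ) with hg
    have hg0 : 0 ≤ g := Nat.cast_nonneg _
    have h1 := norm_E_le' α box₁ box₂ t
    have hc : Nat.gcd (-t * α).val s = Nat.gcd t.val s := by
      rw [show -t * α = t * (-α) by ring]; exact lemma412_gcd_val_mul_of_isUnit t ha.neg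
    have h2 := norm_sum_units_inv_inv_le hK (-t * α) box₁ box₂
    rw [hc] at h2
    calc ‖E t‖ ≤ ‖∑ u ∈ Ub, ∑ v ∈ Vb,
            (ZMod.stdAddChar ((-t * α) * (((u : ZMod s))⁻¹ * ((v : ZMod s))⁻¹)) : ℂ)‖ +
          Ub.card * Vb.card * (g / Nat.totient s) := h1
      _ ≤ (s : ℝ)⁻¹ * g * T * (X₁ * X₂) + box₁.card * box₂.card * (g / Nat.totient s) := by
          apply add_le_add
          · refine h2.trans ?_
            apply mul_le_mul_of_nonneg_left _ (by positivity)
            exact mul_le_mul hG₁ hG₂ (Finset.sum_nonneg fun _ _ => norm_nonneg _) hX₁0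
          · gcongr
      _ = g * W₀ := by rw [hW₀]; field_simp
  -- `‖F t‖ ≤ Φ(tD)` for `t ≠ 0`
  have hFt : ∀ t : ZMod s, t ≠ 0 → ‖F t‖ ≤ Φ (t * Dz) := fun t ht =>
    norm_sum_box_stdAddChar_le hD hDs L₃ R₃ t₃ ht
  -- assemble exactly as in `lemma412_core`
  have habs : |∑ u ∈ box₁, ∑ v ∈ box₂, ∑ w ∈ box₃, gAP s a (u * v * w)| =
      ‖(((∑ u ∈ box₁, ∑ v ∈ box₂, ∑ w ∈ box₃, gAP s a (u * v * w) : ℝ)) : ℂ)‖ := by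
    rw [Complex.norm_real, Real.norm_eq_abs]
  rw [habs, hid, norm_mul, norm_inv, Complex.norm_natCast]
  have h0 : E 0 * F 0 = 0 := by rw [hE0, zero_mul]
  rw [← Finset.sum_erase (f := fun t => E t * F t) Finset.univ h0]
  have hsum : ‖∑ t ∈ (Finset.univ : Finset (ZMod s)).erase 0, E t * F t‖ ≤ W₀ * (τ * s * (1 + Real.log s)) := by
    calc ‖∑ t ∈ (Finset.univ : Finset (ZMod s)).erase 0, E t * F t‖
        ≤ ∑ t ∈ (Finset.univ : Finset (ZMod s)).erase 0, ‖E t * F t‖ := norm_sum_le _ _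
      _ ≤ ∑ t ∈ (Finset.univ : Finset (ZMod s)).erase 0, W₀ * ((Nat.gcd t.val s : ℝ) * Φ (t * Dz)) := by
          refine Finset.sum_le_sum fun t ht => ?_
          have ht0 : t ≠ 0 := Finset.ne_of_mem_erase ht
          rw [norm_mul]
          calc ‖E t‖ * ‖F t‖ ≤ ((Nat.gcd t.val s : ℝ) * W₀) * Φ (t * Dz) :=
                mul_le_mul (hEt t) (hFt t ht0) (norm_nonneg _) (by positivity)
            _ = W₀ * ((Nat.gcd t.val s : ℝ) * Φ (t * Dz)) := by ring
      _ = W₀ * ∑ t ∈ (Finset.univ : Finset (ZMod s)).erase 0, (Nat.gcd t.val s : ℝ) * Φ (t * Dz) := by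
          rw [Finset.mul_sum]
      _ = W₀ * ∑ w ∈ (Finset.univ : Finset (ZMod s)).erase 0, (Nat.gcd w.val s : ℝ) * Φ w := by
          congr 1
          refine Finset.sum_nbij' (fun t => t * Dz) (fun w => w * Dz⁻¹) (fun t ht => ?_)
            (fun w hw => ?_) (fun t _ => ?_) (fun w _ => ?_) (fun t _ => ?_)
          · rw [Finset.mem_erase] at ht ⊢
            refine ⟨fun h0 => ht.1 ?_, Finset.mem_univ _⟩
            have : t * Dz * Dz⁻¹ = 0 := by rw [h0, zero_mul]
            rwa [mul_assoc, ZMod.mul_inv_of_unit _ hDu, mul_one] at this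
          · rw [Finset.mem_erase] at hw ⊢
            refine ⟨fun h0 => hw.1 ?_, Finset.mem_univ _⟩
            have : w * Dz⁻¹ * Dz = 0 := by rw [h0, zero_mul]
            rwa [mul_assoc, mul_comm (Dz⁻¹), ZMod.mul_inv_of_unit _ hDu, mul_one] at this
          · rw [mul_assoc, ZMod.mul_inv_of_unit _ hDu, mul_one]
          · rw [mul_assoc, mul_comm (Dz⁻¹), ZMod.mul_inv_of_unit _ hDu, mul_one]
          · rw [lemma412_gcd_val_mul_of_isUnit t hDu]
      _ ≤ W₀ * (τ * s * (1 + Real.log s)) := by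
          refine mul_le_mul_of_nonneg_left ?_ hW₀0
          have := lemma412_sum_gcd_div_distInt_le s
          simpa only [hΦ, hτ] using this
  calc (s : ℝ)⁻¹ * ‖∑ t ∈ (Finset.univ : Finset (ZMod s)).erase 0, E t * F t‖
      ≤ (s : ℝ)⁻¹ * (W₀ * (τ * s * (1 + Real.log s))) := mul_le_mul_of_nonneg_left hsum (by positivity)
    _ = τ * (1 + Real.log s) * W₀ := by field_simp
    _ = _ := by rw [hW₀, hX₁, hX₂, hLs]

end HeathBrown1986

/-! ### Level `θ < 1/2` for Lemma 4.13, conditional on Smith's bound (3.1) -/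

set_option maxHeartbeats 800000 in
open HeathBrown1986 FouvryTenenbaum2021 in
/-- **Fouvry–Tenenbaum's Lemma 4.13 at every level `θ < 1/2`, conditional on the pointwise bound
(3.1) for the hyper-Kloosterman sum `K₂`** ("By Smith ([27], Theorem 6) we have
(3.1) `|K₂(a; q)| ≤ q (a, q) d₃(q)`", Heath-Brown p. 35; this is Deligne's estimate for `Kl₃` at primes,
R. A. Smith, J. Number Theory 11 (1979) 324–343, Thm 6, combined with Smith's Theorems 2–3 at prime
powers; and "the 'easy' value for `θ₃` is `1/2`", Heath-Brown p. 31).  The hypothesis `hK2` is (3.1)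
verbatim in the notation `K2 q a₁ a₂ a₃ = ∑*_{x,y} e_q(a₁x + a₂y + a₃x̄ȳ)`, `(a, q) = (a₁, a₂, a₃, q)`,
`d3 q = d₃(q)`; it is NOT proved here (no Deligne in the tree) — the theorem isolates exactly what the
level `1/2` needs.  Proof: `abs_sum3_gAP_le_of_K2` (complete all three variables) and the bookkeeping
`d(s)(1+log s)(d₃(s)(2M₁ + s(1+log s))(2M₂ + s(1+log s))/s + 4M₁M₂/φ(s)) ≤ C x^{1−δ}/φ(s)` for
`s ≤ x^θ`, `θ < 1/2` (`M₁M₂ ≤ x^{2/3}`, `M₂ ≤ x^{1/2}`, divisor bound, `log s ≤ s^η/η`).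
[cite: HeathBrown1986d3, §3 (3.1) & p. 31; FouvryTenenbaum2021, Lemma 4.13] -/
theorem FouvryTenenbaum2021_lemma413_of_K2_bound
    (hK2 : ∀ (q : ℕ) [NeZero q] (a₁ a₂ a₃ : ZMod q),
      ‖K2 q a₁ a₂ a₃‖ ≤ q * (Nat.gcd (Nat.gcd (Nat.gcd a₁.val a₂.val) a₃.val) q : ℝ) * d3 q)
    {θ : ℝ} (hθ : θ < 1 / 2) :
    ∃ δ C₀ C : ℝ, 0 < δ ∧ ∀ x : ℝ, 1 ≤ x → ∀ M₁ M₂ M₃ lo₁ hi₁ lo₂ hi₂ lo₃ hi₃ : ℝ,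
      x ^ (1 / 100 : ℝ) ≤ M₁ → M₁ ≤ M₂ → M₂ ≤ M₃ → M₁ * M₂ * M₃ ≤ x →
      M₁ ≤ lo₁ → hi₁ ≤ 2 * M₁ → M₂ ≤ lo₂ → hi₂ ≤ 2 * M₂ → M₃ ≤ lo₃ → hi₃ ≤ 2 * M₃ →
      ∀ (s D : ℕ) (a t₁ t₂ t₃ : ℤ), 1 ≤ s → (s : ℝ) ≤ x ^ θ → 1 ≤ D →
        IsCoprime (s : ℤ) (a * D) → IsCoprime (t₁ * t₂ * t₃) (D : ℤ) →
        |∑ m₁ ∈ (Ioc ⌊lo₁⌋₊ ⌊hi₁⌋₊).filter (fun m : ℕ => (m : ZMod D) = (t₁ : ZMod D)),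
            ∑ m₂ ∈ (Ioc ⌊lo₂⌋₊ ⌊hi₂⌋₊).filter (fun m : ℕ => (m : ZMod D) = (t₂ : ZMod D)),
              ∑ m₃ ∈ (Ioc ⌊lo₃⌋₊ ⌊hi₃⌋₊).filter (fun m : ℕ => (m : ZMod D) = (t₃ : ZMod D)),
                gAP s a (m₁ * m₂ * m₃)| ≤
          C * (D : ℝ) ^ C₀ * x ^ (1 - δ) / (Nat.totient s : ℝ) := by
  -- exponents
  set θ₁ : ℝ := max θ (1 / 4) with hθ₁
  have hθ₁lt : θ₁ < 1 / 2 := max_lt hθ (by norm_num)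
  have hθ₁ge : 1 / 4 ≤ θ₁ := le_max_right _ _
  have hθθ₁ : θ ≤ θ₁ := le_max_left _ _
  set ε₀ : ℝ := 1 - 2 * θ₁ with hε₀
  have hε₀0 : 0 < ε₀ := by rw [hε₀]; linarith
  have hε₀1 : ε₀ ≤ 1 / 2 := by rw [hε₀]; linarith
  set η : ℝ := ε₀ / 8 with hη
  have hη0 : 0 < η := by positivity
  have hη1 : η ≤ 1 / 16 := by rw [hη]; linarith
  obtain ⟨Cτ, hCτ1, hCτ⟩ := exists_card_divisors_le_mul_rpow hη0
  have hCτ0 : 0 ≤ Cτ := zero_le_one.trans hCτ1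
  set c₁ : ℝ := 1 + 1 / η with hc₁
  have hη' : 0 ≤ 1 / η := by positivity
  have hc₁1 : 1 ≤ c₁ := by rw [hc₁]; linarith
  set δ : ℝ := min (1 / 24) (3 * ε₀ / 16) with hδ
  have hδ0 : 0 < δ := lt_min (by norm_num) (by positivity)
  have hδ1 : δ ≤ 1 / 24 := min_le_left _ _
  have hδ2 : δ ≤ 3 * ε₀ / 16 := min_le_right _ _
  -- the exponent inequalities (all linear after `θ₁ η ≤ η/2`)
  have h4 : θ₁ * (4 * η) ≤ 1 / 2 * (4 * η) := mul_le_mul_of_nonneg_right hθ₁lt.le (by positivity)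
  have h5 : θ₁ * (5 * η) ≤ 1 / 2 * (5 * η) := mul_le_mul_of_nonneg_right hθ₁lt.le (by positivity)
  have h6 : θ₁ * (6 * η) ≤ 1 / 2 * (6 * η) := mul_le_mul_of_nonneg_right hθ₁lt.le (by positivity)
  have h2' : θ₁ * (2 * η) ≤ 1 / 2 * (2 * η) := mul_le_mul_of_nonneg_right hθ₁lt.le (by positivity)
  have hexp1 : θ₁ * (4 * η) + 2 / 3 ≤ 1 - δ := by linarith
  have hexp2 : 1 / 2 + θ₁ * (1 + 5 * η) ≤ 1 - δ := by
    have : θ₁ * (1 + 5 * η) = θ₁ + θ₁ * (5 * η) := by ring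
    rw [this]; linarith
  have hexp3 : θ₁ * (2 + 6 * η) ≤ 1 - δ := by
    have : θ₁ * (2 + 6 * η) = 2 * θ₁ + θ₁ * (6 * η) := by ring
    rw [this]; linarith
  have hexp4 : θ₁ * (2 * η) + 2 / 3 ≤ 1 - δ := by linarith
  refine ⟨δ, 0, 13 * Cτ ^ 3 * c₁ ^ 3, hδ0, fun x hx M₁ M₂ M₃ lo₁ hi₁ lo₂ hi₂ lo₃ hi₃ hM₁ h12 h23 hprod
    hlo₁ hhi₁ hlo₂ hhi₂ _ _ s D a t₁ t₂ t₃ hs hsx hD hsa _ => ?_⟩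
  have hs0 : 0 < s := hs
  haveI : NeZero s := ⟨hs0.ne'⟩
  have hsR : (0 : ℝ) < s := by exact_mod_cast hs0
  have hs1 : (1 : ℝ) ≤ s := by exact_mod_cast hs0
  have hD0 : 0 < D := hD
  have hφ : (0 : ℝ) < Nat.totient s := by exact_mod_cast Nat.totient_pos.2 hs0
  have hφs : (Nat.totient s : ℝ) ≤ s := by exact_mod_cast Nat.totient_le s
  have hDs : D.Coprime s := coprime_of_isCoprime_mul hsa
  have ha : IsUnit ((a : ℤ) : ZMod s) := (ZMod.coe_int_isUnit_iff_isCoprime a s).2 hsa.of_mul_right_left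
  have hx0 : 0 < x := by linarith
  have hx1 : (1 : ℝ) ≤ x ^ (1 / 100 : ℝ) := Real.one_le_rpow hx (by norm_num)
  have hM₁1 : 1 ≤ M₁ := hx1.trans hM₁
  have hM₁0 : 0 ≤ M₁ := zero_le_one.trans hM₁1
  have hM₂1 : 1 ≤ M₂ := hM₁1.trans h12
  have hM₂0 : 0 ≤ M₂ := zero_le_one.trans hM₂1
  rw [Real.rpow_zero, mul_one]
  -- the per-`s` form of Smith's bound
  have hK : ∀ c₁' c₂ c₃ : ZMod s, ‖K2 s c₁' c₂ c₃‖ ≤ s * (Nat.gcd c₃.val s : ℝ) * d3 s := by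
    intro c₁' c₂ c₃
    refine (hK2 s c₁' c₂ c₃).trans ?_
    have hle : Nat.gcd (Nat.gcd (Nat.gcd c₁'.val c₂.val) c₃.val) s ≤ Nat.gcd c₃.val s :=
      Nat.le_of_dvd (Nat.gcd_pos_of_pos_right _ hs0)
        (Nat.dvd_gcd ((Nat.gcd_dvd_left _ _).trans (Nat.gcd_dvd_right _ _)) (Nat.gcd_dvd_right _ _))
    have : (Nat.gcd (Nat.gcd (Nat.gcd c₁'.val c₂.val) c₃.val) s : ℝ) ≤ Nat.gcd c₃.val s := by
      exact_mod_cast hle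
    gcongr
  have hd30 : (0 : ℝ) ≤ d3 s := Nat.cast_nonneg _
  have hcore := abs_sum3_gAP_le_of_K2 hD0 hDs ha hd30 hK ⌊lo₁⌋₊ ⌊hi₁⌋₊ ⌊lo₂⌋₊ ⌊hi₂⌋₊ ⌊lo₃⌋₊ ⌊hi₃⌋₊
    t₁ t₂ t₃
  refine hcore.trans ?_
  -- names
  set b₁ : ℝ := ((((Ioc ⌊lo₁⌋₊ ⌊hi₁⌋₊).filter (fun m : ℕ => (m : ZMod D) = (t₁ : ZMod D))).card : ℕ) : ℝ)
    with hb₁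
  set b₂ : ℝ := ((((Ioc ⌊lo₂⌋₊ ⌊hi₂⌋₊).filter (fun m : ℕ => (m : ZMod D) = (t₂ : ZMod D))).card : ℕ) : ℝ)
    with hb₂
  set d : ℝ := ((Nat.divisors s).card : ℝ) with hd
  set L : ℝ := 1 + Real.log s with hL
  have hL0 : 0 ≤ L := by have := Real.log_nonneg hs1; rw [hL]; linarith
  have hL1 : 1 ≤ L := by have := Real.log_nonneg hs1; rw [hL]; linarith
  have hb₁0 : 0 ≤ b₁ := Nat.cast_nonneg _
  have hb₂0 : 0 ≤ b₂ := Nat.cast_nonneg _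
  have hb₁le : b₁ ≤ 2 * M₁ := card_apBox_le_two_mul hM₁1 hlo₁ hhi₁ D t₁
  have hb₂le : b₂ ≤ 2 * M₂ := card_apBox_le_two_mul hM₂1 hlo₂ hhi₂ D t₂
  -- sizes of `M₁ M₂` and `M₂`
  have hM12 : M₁ * M₂ ≤ x ^ (2 / 3 : ℝ) := mul_le_rpow_two_thirds hM₁0 hM₂0 (h12.trans h23) h23 hx0.le hprod
  have hM₂ : M₂ ≤ x ^ (1 / 2 : ℝ) := by
    have hsq : M₂ ^ 2 ≤ x := by
      have : M₂ * M₂ ≤ M₂ * M₃ := mul_le_mul_of_nonneg_left h23 hM₂0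
      have h2 : M₂ * M₃ ≤ M₁ * M₂ * M₃ := by
        have : 1 * (M₂ * M₃) ≤ M₁ * (M₂ * M₃) :=
          mul_le_mul_of_nonneg_right hM₁1 (mul_nonneg hM₂0 (hM₂0.trans h23))
        linarith [mul_assoc M₁ M₂ M₃]
      nlinarith
    calc M₂ = (M₂ ^ 2) ^ (((2 : ℕ) : ℝ)⁻¹) := (Real.pow_rpow_inv_natCast hM₂0 (by norm_num)).symm
      _ ≤ x ^ (((2 : ℕ) : ℝ)⁻¹) := Real.rpow_le_rpow (pow_nonneg hM₂0 _) hsq (by positivity)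
      _ = x ^ (1 / 2 : ℝ) := by norm_num
  have hM₁le : M₁ ≤ x ^ (1 / 2 : ℝ) := h12.trans hM₂
  -- the small factors
  have hdle : d ≤ Cτ * (s : ℝ) ^ η := hCτ s hs0.ne'
  have hd0 : 0 ≤ d := Nat.cast_nonneg _
  have hLle : L ≤ c₁ * (s : ℝ) ^ η := by
    have h1 : Real.log s ≤ (s : ℝ) ^ η / η := Real.log_le_rpow_div hsR.le hη0
    have h2 : (1 : ℝ) ≤ (s : ℝ) ^ η := Real.one_le_rpow hs1 hη0.le
    have h3 : c₁ * (s : ℝ) ^ η = (s : ℝ) ^ η + (s : ℝ) ^ η / η := by rw [hc₁]; ring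
    rw [h3, hL]; linarith
  have hd3le : (d3 s : ℝ) ≤ d ^ 2 := by
    have := d3_le s
    rw [hd]; exact_mod_cast this
  -- `s^e ≤ x^{θ₁ e}`
  have hsx₁ : (s : ℝ) ≤ x ^ θ₁ := hsx.trans (Real.rpow_le_rpow_of_exponent_le hx hθθ₁)
  have hspow : ∀ e : ℝ, 0 ≤ e → (s : ℝ) ^ e ≤ x ^ (θ₁ * e) := by
    intro e he
    calc (s : ℝ) ^ e ≤ (x ^ θ₁) ^ e := Real.rpow_le_rpow hsR.le hsx₁ he
      _ = x ^ (θ₁ * e) := by rw [← Real.rpow_mul hx0.le]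
  have hxpow : ∀ e : ℝ, e ≤ 1 - δ → x ^ e ≤ x ^ (1 - δ) := fun e he =>
    Real.rpow_le_rpow_of_exponent_le hx he
  -- the product `d · d3 · L ≤ Cτ³ c₁ s^{4η}` and `d L ≤ Cτ c₁ s^{2η}`
  have hdL : d * L ≤ Cτ * c₁ * (s : ℝ) ^ (2 * η) := by
    calc d * L ≤ (Cτ * (s : ℝ) ^ η) * (c₁ * (s : ℝ) ^ η) := mul_le_mul hdle hLle hL0 (by positivity)
      _ = Cτ * c₁ * ((s : ℝ) ^ η * (s : ℝ) ^ η) := by ring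
      _ = Cτ * c₁ * (s : ℝ) ^ (2 * η) := by rw [← Real.rpow_add hsR]; ring_nf
  have hdd3L : d * L * (d3 s : ℝ) ≤ Cτ ^ 3 * c₁ * (s : ℝ) ^ (4 * η) := by
    calc d * L * (d3 s : ℝ) ≤ (Cτ * c₁ * (s : ℝ) ^ (2 * η)) * (Cτ * (s : ℝ) ^ η) ^ 2 := by
          apply mul_le_mul hdL (hd3le.trans (pow_le_pow_left₀ hd0 hdle 2)) hd30 (by positivity)
      _ = Cτ ^ 3 * c₁ * ((s : ℝ) ^ (2 * η) * ((s : ℝ) ^ η * (s : ℝ) ^ η)) := by ring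
      _ = Cτ ^ 3 * c₁ * (s : ℝ) ^ (4 * η) := by
          rw [← Real.rpow_add hsR, ← Real.rpow_add hsR]; ring_nf
  -- Step: clear `φ(s)`
  rw [le_div_iff₀ hφ]
  have hsL : (s : ℝ) * L ≤ c₁ * (s : ℝ) ^ (1 + η) := by
    calc (s : ℝ) * L ≤ (s : ℝ) * (c₁ * (s : ℝ) ^ η) := mul_le_mul_of_nonneg_left hLle hsR.le
      _ = c₁ * ((s : ℝ) ^ (1 : ℝ) * (s : ℝ) ^ η) := by rw [Real.rpow_one]; ring
      _ = c₁ * (s : ℝ) ^ (1 + η) := by rw [← Real.rpow_add hsR]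
  -- the four terms
  have hX : (b₁ + (s : ℝ) * L) * (b₂ + (s : ℝ) * L) ≤
      4 * x ^ (2 / 3 : ℝ) + 4 * x ^ (1 / 2 : ℝ) * ((s : ℝ) * L) + ((s : ℝ) * L) ^ 2 := by
    have h1 : b₁ * b₂ ≤ 4 * x ^ (2 / 3 : ℝ) := by
      calc b₁ * b₂ ≤ (2 * M₁) * (2 * M₂) := mul_le_mul hb₁le hb₂le hb₂0 (by positivity)
        _ = 4 * (M₁ * M₂) := by ring
        _ ≤ 4 * x ^ (2 / 3 : ℝ) := by linarith
    have h2 : b₁ + b₂ ≤ 4 * x ^ (1 / 2 : ℝ) := by linarith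
    have hsL0 : 0 ≤ (s : ℝ) * L := by positivity
    calc (b₁ + (s : ℝ) * L) * (b₂ + (s : ℝ) * L)
        = b₁ * b₂ + (b₁ + b₂) * ((s : ℝ) * L) + ((s : ℝ) * L) ^ 2 := by ring
      _ ≤ 4 * x ^ (2 / 3 : ℝ) + (4 * x ^ (1 / 2 : ℝ)) * ((s : ℝ) * L) + ((s : ℝ) * L) ^ 2 := by gcongr
      _ = _ := by ring
  have hA : d * L * ((d3 s : ℝ) * ((b₁ + (s : ℝ) * L) * (b₂ + (s : ℝ) * L)) / s) * (Nat.totient s : ℝ) ≤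
      9 * Cτ ^ 3 * c₁ ^ 3 * x ^ (1 - δ) := by
    -- `φ(s)/s ≤ 1`
    have h1 : d * L * ((d3 s : ℝ) * ((b₁ + (s : ℝ) * L) * (b₂ + (s : ℝ) * L)) / s) * (Nat.totient s : ℝ) ≤
        (d * L * (d3 s : ℝ)) * ((b₁ + (s : ℝ) * L) * (b₂ + (s : ℝ) * L)) := by
      have hq : (Nat.totient s : ℝ) / s ≤ 1 := (div_le_one hsR).mpr hφs
      have hnn : 0 ≤ (d * L * (d3 s : ℝ)) * ((b₁ + (s : ℝ) * L) * (b₂ + (s : ℝ) * L)) := by positivity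
      calc d * L * ((d3 s : ℝ) * ((b₁ + (s : ℝ) * L) * (b₂ + (s : ℝ) * L)) / s) * (Nat.totient s : ℝ)
          = (d * L * (d3 s : ℝ)) * ((b₁ + (s : ℝ) * L) * (b₂ + (s : ℝ) * L)) * ((Nat.totient s : ℝ) / s) := by
            field_simp
        _ ≤ (d * L * (d3 s : ℝ)) * ((b₁ + (s : ℝ) * L) * (b₂ + (s : ℝ) * L)) * 1 := by gcongr
        _ = _ := by ring
    refine h1.trans ?_
    have h2 : (d * L * (d3 s : ℝ)) * ((b₁ + (s : ℝ) * L) * (b₂ + (s : ℝ) * L)) ≤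
        (Cτ ^ 3 * c₁ * (s : ℝ) ^ (4 * η)) *
          (4 * x ^ (2 / 3 : ℝ) + 4 * x ^ (1 / 2 : ℝ) * (c₁ * (s : ℝ) ^ (1 + η)) + (c₁ * (s : ℝ) ^ (1 + η)) ^ 2) := by
      apply mul_le_mul hdd3L _ (by positivity) (by positivity)
      refine hX.trans ?_
      have hsL0 : 0 ≤ (s : ℝ) * L := by positivity
      gcongr
    refine h2.trans ?_
    -- each of the three products is `≤ x^{1-δ}` up to the constant
    have e1 : (s : ℝ) ^ (4 * η) * x ^ (2 / 3 : ℝ) ≤ x ^ (1 - δ) := by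
      calc (s : ℝ) ^ (4 * η) * x ^ (2 / 3 : ℝ) ≤ x ^ (θ₁ * (4 * η)) * x ^ (2 / 3 : ℝ) := by
            gcongr; exact hspow _ (by positivity)
        _ = x ^ (θ₁ * (4 * η) + 2 / 3) := by rw [← Real.rpow_add hx0]
        _ ≤ x ^ (1 - δ) := hxpow _ hexp1
    have e2 : (s : ℝ) ^ (4 * η) * (x ^ (1 / 2 : ℝ) * (s : ℝ) ^ (1 + η)) ≤ x ^ (1 - δ) := by
      calc (s : ℝ) ^ (4 * η) * (x ^ (1 / 2 : ℝ) * (s : ℝ) ^ (1 + η))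
          = x ^ (1 / 2 : ℝ) * ((s : ℝ) ^ (4 * η) * (s : ℝ) ^ (1 + η)) := by ring
        _ = x ^ (1 / 2 : ℝ) * (s : ℝ) ^ (1 + 5 * η) := by rw [← Real.rpow_add hsR]; ring_nf
        _ ≤ x ^ (1 / 2 : ℝ) * x ^ (θ₁ * (1 + 5 * η)) := by gcongr; exact hspow _ (by positivity)
        _ = x ^ (1 / 2 + θ₁ * (1 + 5 * η)) := by rw [← Real.rpow_add hx0]
        _ ≤ x ^ (1 - δ) := hxpow _ hexp2
    have e3 : (s : ℝ) ^ (4 * η) * ((s : ℝ) ^ (1 + η)) ^ 2 ≤ x ^ (1 - δ) := by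
      calc (s : ℝ) ^ (4 * η) * ((s : ℝ) ^ (1 + η)) ^ 2
          = (s : ℝ) ^ (4 * η) * ((s : ℝ) ^ (1 + η) * (s : ℝ) ^ (1 + η)) := by ring
        _ = (s : ℝ) ^ (2 + 6 * η) := by rw [← Real.rpow_add hsR, ← Real.rpow_add hsR]; ring_nf
        _ ≤ x ^ (θ₁ * (2 + 6 * η)) := hspow _ (by positivity)
        _ ≤ x ^ (1 - δ) := hxpow _ hexp3
    have hx1δ : 0 ≤ x ^ (1 - δ) := by positivity
    calc (Cτ ^ 3 * c₁ * (s : ℝ) ^ (4 * η)) *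
          (4 * x ^ (2 / 3 : ℝ) + 4 * x ^ (1 / 2 : ℝ) * (c₁ * (s : ℝ) ^ (1 + η)) + (c₁ * (s : ℝ) ^ (1 + η)) ^ 2)
        = Cτ ^ 3 * c₁ * (4 * ((s : ℝ) ^ (4 * η) * x ^ (2 / 3 : ℝ))) +
          Cτ ^ 3 * c₁ ^ 2 * (4 * ((s : ℝ) ^ (4 * η) * (x ^ (1 / 2 : ℝ) * (s : ℝ) ^ (1 + η)))) +
          Cτ ^ 3 * c₁ ^ 3 * ((s : ℝ) ^ (4 * η) * ((s : ℝ) ^ (1 + η)) ^ 2) := by ring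
      _ ≤ Cτ ^ 3 * c₁ * (4 * x ^ (1 - δ)) + Cτ ^ 3 * c₁ ^ 2 * (4 * x ^ (1 - δ)) +
          Cτ ^ 3 * c₁ ^ 3 * x ^ (1 - δ) := by gcongr
      _ ≤ Cτ ^ 3 * c₁ ^ 3 * (4 * x ^ (1 - δ)) + Cτ ^ 3 * c₁ ^ 3 * (4 * x ^ (1 - δ)) +
          Cτ ^ 3 * c₁ ^ 3 * x ^ (1 - δ) := by
          have hc3 : c₁ ^ 2 ≤ c₁ ^ 3 := pow_le_pow_right₀ hc₁1 (by norm_num)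
          have hc2 : c₁ ≤ c₁ ^ 3 := by
            calc c₁ = c₁ ^ 1 := (pow_one c₁).symm
              _ ≤ c₁ ^ 3 := pow_le_pow_right₀ hc₁1 (by norm_num)
          gcongr
      _ = 9 * Cτ ^ 3 * c₁ ^ 3 * x ^ (1 - δ) := by ring
  have hB : d * L * (b₁ * b₂ / (Nat.totient s : ℝ)) * (Nat.totient s : ℝ) ≤ 4 * Cτ ^ 3 * c₁ ^ 3 * x ^ (1 - δ) := by
    have h1 : d * L * (b₁ * b₂ / (Nat.totient s : ℝ)) * (Nat.totient s : ℝ) = d * L * (b₁ * b₂) := by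
      field_simp
    rw [h1]
    have h2 : b₁ * b₂ ≤ 4 * x ^ (2 / 3 : ℝ) := by
      calc b₁ * b₂ ≤ (2 * M₁) * (2 * M₂) := mul_le_mul hb₁le hb₂le hb₂0 (by positivity)
        _ = 4 * (M₁ * M₂) := by ring
        _ ≤ 4 * x ^ (2 / 3 : ℝ) := by linarith
    calc d * L * (b₁ * b₂) ≤ (Cτ * c₁ * (s : ℝ) ^ (2 * η)) * (4 * x ^ (2 / 3 : ℝ)) :=
          mul_le_mul hdL h2 (by positivity) (by positivity)
      _ = 4 * Cτ * c₁ * ((s : ℝ) ^ (2 * η) * x ^ (2 / 3 : ℝ)) := by ring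
      _ ≤ 4 * Cτ * c₁ * x ^ (1 - δ) := by
          gcongr
          calc (s : ℝ) ^ (2 * η) * x ^ (2 / 3 : ℝ) ≤ x ^ (θ₁ * (2 * η)) * x ^ (2 / 3 : ℝ) := by
                gcongr; exact hspow _ (by positivity)
            _ = x ^ (θ₁ * (2 * η) + 2 / 3) := by rw [← Real.rpow_add hx0]
            _ ≤ x ^ (1 - δ) := hxpow _ hexp4
      _ ≤ 4 * Cτ ^ 3 * c₁ ^ 3 * x ^ (1 - δ) := by
          have h3 : Cτ * c₁ ≤ Cτ ^ 3 * c₁ ^ 3 := by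
            have h4 : 1 ≤ Cτ ^ 2 * c₁ ^ 2 :=
              one_le_mul_of_one_le_of_one_le (one_le_pow₀ hCτ1) (one_le_pow₀ hc₁1)
            have h5 : 0 ≤ Cτ * c₁ := mul_nonneg hCτ0 (zero_le_one.trans hc₁1)
            calc Cτ * c₁ = Cτ * c₁ * 1 := by ring
              _ ≤ Cτ * c₁ * (Cτ ^ 2 * c₁ ^ 2) := by gcongr
              _ = Cτ ^ 3 * c₁ ^ 3 := by ring
          have hx1δ : 0 ≤ x ^ (1 - δ) := by positivity
          calc 4 * Cτ * c₁ * x ^ (1 - δ) = 4 * (Cτ * c₁) * x ^ (1 - δ) := by ring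
            _ ≤ 4 * (Cτ ^ 3 * c₁ ^ 3) * x ^ (1 - δ) := by gcongr
            _ = _ := by ring
  calc (d * L * ((d3 s : ℝ) * ((b₁ + (s : ℝ) * L) * (b₂ + (s : ℝ) * L)) / s + b₁ * b₂ / (Nat.totient s : ℝ))) *
        (Nat.totient s : ℝ)
      = d * L * ((d3 s : ℝ) * ((b₁ + (s : ℝ) * L) * (b₂ + (s : ℝ) * L)) / s) * (Nat.totient s : ℝ) +
        d * L * (b₁ * b₂ / (Nat.totient s : ℝ)) * (Nat.totient s : ℝ) := by ring
    _ ≤ 9 * Cτ ^ 3 * c₁ ^ 3 * x ^ (1 - δ) + 4 * Cτ ^ 3 * c₁ ^ 3 * x ^ (1 - δ) := add_le_add hA hB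
    _ = 13 * Cτ ^ 3 * c₁ ^ 3 * x ^ (1 - δ) := by ring

/-! ## Multiplicativity of `K₂` and (3.1) from prime powers -/

namespace HeathBrown1986

open Literature.NumberTheory.LFunctions (stdAddChar_eq_mul_of_coprime isUnit_iff_of_coprime
  castHom_inv_of_isUnit val_inv_natCast_coprime)
open scoped ArithmeticFunction.sigma ArithmeticFunction.zeta

/-! ### `d₃` is multiplicative -/

/-- `d₃ = σ₀ * ζ` as an arithmetic function. [folklore] -/
theorem d3_eq_sigma_mul_zeta (q : ℕ) : d3 q = ((σ 0) * ζ : ArithmeticFunction ℕ) q := by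
  rw [ArithmeticFunction.mul_zeta_apply]
  unfold d3
  refine Finset.sum_congr rfl fun d _ => ?_
  rw [ArithmeticFunction.sigma_zero_apply]

/-- `d₃(c₁c₂) = d₃(c₁) d₃(c₂)` for coprime `c₁, c₂`. [folklore] -/
theorem d3_mul_of_coprime {c₁ c₂ : ℕ} (h : c₁.Coprime c₂) : d3 (c₁ * c₂) = d3 c₁ * d3 c₂ := by
  rw [d3_eq_sigma_mul_zeta, d3_eq_sigma_mul_zeta, d3_eq_sigma_mul_zeta]
  exact ((ArithmeticFunction.isMultiplicative_sigma (k := 0)).mul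
    ArithmeticFunction.isMultiplicative_zeta).map_mul_of_coprime h

/-! ### Twisted multiplicativity of `K₂` -/

/-- **Twisted multiplicativity of `K₂`** (cf. Heath-Brown (3.4), Smith, Hooley [16] Lemma 3): for coprime
moduli, `K₂(a; c₁c₂) = K₂(c̄₂a; c₁) K₂(c̄₁a; c₂)` with `c̄₂c₂ ≡ 1 (mod c₁)`, `c̄₁c₁ ≡ 1 (mod c₂)` and `a`
reduced modulo `c₁`, `c₂` on the right. [cite: HeathBrown1986d3, §3 (3.4)] -/
theorem K2_mul_of_coprime {c₁ c₂ : ℕ} [NeZero c₁] [NeZero c₂] [NeZero (c₁ * c₂)]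
    (h : c₁.Coprime c₂) (a₁ a₂ a₃ : ZMod (c₁ * c₂)) :
    K2 (c₁ * c₂) a₁ a₂ a₃ =
      K2 c₁ ((c₂ : ZMod c₁)⁻¹ * ZMod.castHom (dvd_mul_right c₁ c₂) (ZMod c₁) a₁)
          ((c₂ : ZMod c₁)⁻¹ * ZMod.castHom (dvd_mul_right c₁ c₂) (ZMod c₁) a₂)
          ((c₂ : ZMod c₁)⁻¹ * ZMod.castHom (dvd_mul_right c₁ c₂) (ZMod c₁) a₃) *
        K2 c₂ ((c₁ : ZMod c₂)⁻¹ * ZMod.castHom (dvd_mul_left c₂ c₁) (ZMod c₂) a₁)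
          ((c₁ : ZMod c₂)⁻¹ * ZMod.castHom (dvd_mul_left c₂ c₁) (ZMod c₂) a₂)
          ((c₁ : ZMod c₂)⁻¹ * ZMod.castHom (dvd_mul_left c₂ c₁) (ZMod c₂) a₃) := by
  classical
  set π₁ := ZMod.castHom (dvd_mul_right c₁ c₂) (ZMod c₁) with hπ₁
  set π₂ := ZMod.castHom (dvd_mul_left c₂ c₁) (ZMod c₂) with hπ₂
  set e₂ : ZMod c₁ := (c₂ : ZMod c₁)⁻¹ with he₂
  set e₁ : ZMod c₂ := (c₁ : ZMod c₂)⁻¹ with he₁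
  set E := ZMod.chineseRemainder h with hE
  have hE1 : ∀ x, (E x).1 = π₁ x := fun x => Prod.fst_zmod_cast x
  have hE2 : ∀ x, (E x).2 = π₂ x := fun x => Prod.snd_zmod_cast x
  -- the summand in product form
  set g₁ : ZMod c₁ → ZMod c₁ → ℂ := fun x₁ y₁ =>
    if IsUnit x₁ ∧ IsUnit y₁ then
      (ZMod.stdAddChar (e₂ * π₁ a₁ * x₁ + e₂ * π₁ a₂ * y₁ + e₂ * π₁ a₃ * (x₁⁻¹ * y₁⁻¹)) : ℂ) else 0
    with hg₁
  set g₂ : ZMod c₂ → ZMod c₂ → ℂ := fun x₂ y₂ =>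
    if IsUnit x₂ ∧ IsUnit y₂ then
      (ZMod.stdAddChar (e₁ * π₂ a₁ * x₂ + e₁ * π₂ a₂ * y₂ + e₁ * π₂ a₃ * (x₂⁻¹ * y₂⁻¹)) : ℂ) else 0
    with hg₂
  have hS : K2 (c₁ * c₂) a₁ a₂ a₃ =
      ∑ x : ZMod (c₁ * c₂), ∑ y : ZMod (c₁ * c₂), g₁ (E x).1 (E y).1 * g₂ (E x).2 (E y).2 := by
    unfold K2
    refine Finset.sum_congr rfl fun x _ => Finset.sum_congr rfl fun y _ => ?_
    rw [hE1, hE2, hE1, hE2]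
    by_cases hxy : IsUnit x ∧ IsUnit y
    · obtain ⟨hx1, hx2⟩ := (isUnit_iff_of_coprime h x).mp hxy.1
      obtain ⟨hy1, hy2⟩ := (isUnit_iff_of_coprime h y).mp hxy.2
      rw [if_pos hxy]
      simp only [hg₁, hg₂]
      rw [if_pos ⟨hx1, hy1⟩, if_pos ⟨hx2, hy2⟩, stdAddChar_eq_mul_of_coprime h]
      congr 2
      · rw [map_add, map_add, map_mul, map_mul, map_mul, map_mul, castHom_inv_of_isUnit _ hxy.1,
          castHom_inv_of_isUnit _ hxy.2]
        ring
      · rw [map_add, map_add, map_mul, map_mul, map_mul, map_mul, castHom_inv_of_isUnit _ hxy.1,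
          castHom_inv_of_isUnit _ hxy.2]
        ring
    · rw [if_neg hxy]
      simp only [hg₁, hg₂]
      by_cases h1 : IsUnit (π₁ x) ∧ IsUnit (π₁ y)
      · have h2 : ¬ (IsUnit (π₂ x) ∧ IsUnit (π₂ y)) := by
          rintro ⟨hx2, hy2⟩
          exact hxy ⟨(isUnit_iff_of_coprime h x).mpr ⟨h1.1, hx2⟩,
            (isUnit_iff_of_coprime h y).mpr ⟨h1.2, hy2⟩⟩
        rw [if_neg h2, mul_zero]
      · rw [if_neg h1, zero_mul]
  rw [hS]
  -- reindex both variables through `E`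
  have step1 : ∑ x : ZMod (c₁ * c₂), ∑ y : ZMod (c₁ * c₂), g₁ (E x).1 (E y).1 * g₂ (E x).2 (E y).2 =
      ∑ x : ZMod (c₁ * c₂), ∑ yy : ZMod c₁ × ZMod c₂, g₁ (E x).1 yy.1 * g₂ (E x).2 yy.2 := by
    refine Finset.sum_congr rfl fun x _ => ?_
    exact Fintype.sum_equiv E.toEquiv (fun y => g₁ (E x).1 (E y).1 * g₂ (E x).2 (E y).2)
      (fun yy : ZMod c₁ × ZMod c₂ => g₁ (E x).1 yy.1 * g₂ (E x).2 yy.2) (fun y => rfl)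
  have step2 : ∑ x : ZMod (c₁ * c₂), ∑ yy : ZMod c₁ × ZMod c₂, g₁ (E x).1 yy.1 * g₂ (E x).2 yy.2 =
      ∑ xx : ZMod c₁ × ZMod c₂, ∑ yy : ZMod c₁ × ZMod c₂, g₁ xx.1 yy.1 * g₂ xx.2 yy.2 :=
    Fintype.sum_equiv E.toEquiv (fun x => ∑ yy : ZMod c₁ × ZMod c₂, g₁ (E x).1 yy.1 * g₂ (E x).2 yy.2)
      (fun xx : ZMod c₁ × ZMod c₂ => ∑ yy : ZMod c₁ × ZMod c₂, g₁ xx.1 yy.1 * g₂ xx.2 yy.2) (fun x => rfl)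
  rw [step1, step2, Fintype.sum_prod_type]
  simp_rw [Fintype.sum_prod_type]
  -- `∑_{x₁} ∑_{x₂} ∑_{y₁} ∑_{y₂} g₁ x₁ y₁ g₂ x₂ y₂ = (∑∑ g₁)(∑∑ g₂)`
  have : ∀ x₁ : ZMod c₁, ∑ x₂ : ZMod c₂, ∑ y₁ : ZMod c₁, ∑ y₂ : ZMod c₂, g₁ x₁ y₁ * g₂ x₂ y₂ =
      (∑ y₁ : ZMod c₁, g₁ x₁ y₁) * ∑ x₂ : ZMod c₂, ∑ y₂ : ZMod c₂, g₂ x₂ y₂ := by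
    intro x₁
    rw [Finset.sum_comm, Finset.sum_mul]
    refine Finset.sum_congr rfl fun y₁ _ => ?_
    rw [Finset.mul_sum]
    refine Finset.sum_congr rfl fun x₂ _ => ?_
    rw [Finset.mul_sum]
  rw [Finset.sum_congr rfl (fun x₁ _ => this x₁), ← Finset.sum_mul]
  rfl

/-! ### (3.1) from prime powers -/

/-- The gcd of (3.1) is insensitive to a twist by a unit. [folklore] -/
theorem gcd3_mul_natAbs {e c : ℕ} (he : e.Coprime c) (m₁ m₂ m₃ : ℤ) :
    Nat.gcd (Nat.gcd (Nat.gcd ((e : ℤ) * m₁).natAbs ((e : ℤ) * m₂).natAbs) ((e : ℤ) * m₃).natAbs) c =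
      Nat.gcd (Nat.gcd (Nat.gcd m₁.natAbs m₂.natAbs) m₃.natAbs) c := by
  rw [Int.natAbs_mul, Int.natAbs_mul, Int.natAbs_mul, Int.natAbs_natCast, Nat.gcd_mul_left,
    Nat.gcd_mul_left, Nat.Coprime.gcd_mul_left_cancel _ he]

/-- The right-hand side of (3.1) is multiplicative over coprime moduli. [folklore] -/
theorem smith_rhs_mul {c₁ c₂ : ℕ} (h : c₁.Coprime c₂) (g : ℕ) :
    ((c₁ * c₂ : ℕ) : ℝ) * (Nat.gcd g (c₁ * c₂) : ℝ) * (d3 (c₁ * c₂) : ℝ) =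
      ((c₁ : ℝ) * (Nat.gcd g c₁ : ℝ) * (d3 c₁ : ℝ)) * ((c₂ : ℝ) * (Nat.gcd g c₂ : ℝ) * (d3 c₂ : ℝ)) := by
  rw [Nat.Coprime.gcd_mul _ h, d3_mul_of_coprime h]
  push_cast
  ring

/-- **Smith's bound (3.1) for all moduli from prime-power moduli**: if
`|K₂(a; p^k)| ≤ p^k (a, p^k) d₃(p^k)` for all prime powers and integer vectors `a`, then
`|K₂(a; q)| ≤ q (a, q) d₃(q)` for all `q ≥ 1` (twisted multiplicativity of `K₂` and the
multiplicativity of `q ↦ q (a, q) d₃(q)`). [cite: HeathBrown1986d3, §3 (3.1) & (3.4)] -/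
theorem K2_bound_of_primePow
    (H : ∀ (c : ℕ) [NeZero c], (∃ p k : ℕ, p.Prime ∧ c = p ^ k) → ∀ m₁ m₂ m₃ : ℤ,
      ‖K2 c (m₁ : ZMod c) (m₂ : ZMod c) (m₃ : ZMod c)‖ ≤
        c * (Nat.gcd (Nat.gcd (Nat.gcd m₁.natAbs m₂.natAbs) m₃.natAbs) c : ℝ) * d3 c)
    (c : ℕ) [NeZero c] (m₁ m₂ m₃ : ℤ) :
    ‖K2 c (m₁ : ZMod c) (m₂ : ZMod c) (m₃ : ZMod c)‖ ≤
      c * (Nat.gcd (Nat.gcd (Nat.gcd m₁.natAbs m₂.natAbs) m₃.natAbs) c : ℝ) * d3 c := by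
  suffices key : ∀ c : ℕ, ∀ hc : c ≠ 0, ∀ m₁ m₂ m₃ : ℤ,
      ‖@K2 c ⟨hc⟩ (m₁ : ZMod c) (m₂ : ZMod c) (m₃ : ZMod c)‖ ≤
        c * (Nat.gcd (Nat.gcd (Nat.gcd m₁.natAbs m₂.natAbs) m₃.natAbs) c : ℝ) * d3 c by
    exact key c (NeZero.ne c) m₁ m₂ m₃
  intro c
  induction c using Nat.recOnPrimeCoprime with
  | zero => intro hc; exact absurd rfl hc
  | prime_pow p k hp =>
      intro hc m₁ m₂ m₃
      haveI : NeZero (p ^ k) := ⟨hc⟩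
      exact H (p ^ k) ⟨p, k, hp, rfl⟩ m₁ m₂ m₃
  | coprime c₁ c₂ hc₁ hc₂ hcop ih₁ ih₂ =>
      intro hc m₁ m₂ m₃
      haveI : NeZero c₁ := ⟨by omega⟩
      haveI : NeZero c₂ := ⟨by omega⟩
      haveI : NeZero (c₁ * c₂) := ⟨hc⟩
      have hcop₂ : ((c₂ : ZMod c₁)⁻¹).val.Coprime c₁ := val_inv_natCast_coprime hcop
      have hcop₁ : ((c₁ : ZMod c₂)⁻¹).val.Coprime c₂ := val_inv_natCast_coprime hcop.symm
      have hfac := K2_mul_of_coprime hcop (m₁ : ZMod (c₁ * c₂)) (m₂ : ZMod (c₁ * c₂))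
        (m₃ : ZMod (c₁ * c₂))
      have hcast₁ : ∀ k : ℤ, (c₂ : ZMod c₁)⁻¹ *
          ZMod.castHom (dvd_mul_right c₁ c₂) (ZMod c₁) (k : ZMod (c₁ * c₂)) =
            (((((c₂ : ZMod c₁)⁻¹).val : ℤ) * k : ℤ) : ZMod c₁) := by
        intro k; rw [map_intCast]; push_cast; rw [ZMod.natCast_zmod_val]
      have hcast₂ : ∀ k : ℤ, (c₁ : ZMod c₂)⁻¹ *
          ZMod.castHom (dvd_mul_left c₂ c₁) (ZMod c₂) (k : ZMod (c₁ * c₂)) =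
            (((((c₁ : ZMod c₂)⁻¹).val : ℤ) * k : ℤ) : ZMod c₂) := by
        intro k; rw [map_intCast]; push_cast; rw [ZMod.natCast_zmod_val]
      rw [hcast₁, hcast₁, hcast₁, hcast₂, hcast₂, hcast₂] at hfac
      have hb₁ := ih₁ (NeZero.ne c₁) ((((c₂ : ZMod c₁)⁻¹).val : ℤ) * m₁)
        ((((c₂ : ZMod c₁)⁻¹).val : ℤ) * m₂) ((((c₂ : ZMod c₁)⁻¹).val : ℤ) * m₃)
      have hb₂ := ih₂ (NeZero.ne c₂) ((((c₁ : ZMod c₂)⁻¹).val : ℤ) * m₁)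
        ((((c₁ : ZMod c₂)⁻¹).val : ℤ) * m₂) ((((c₁ : ZMod c₂)⁻¹).val : ℤ) * m₃)
      rw [gcd3_mul_natAbs hcop₂] at hb₁
      rw [gcd3_mul_natAbs hcop₁] at hb₂
      rw [hfac, norm_mul, smith_rhs_mul hcop]
      exact mul_le_mul hb₁ hb₂ (norm_nonneg _) (by positivity)

/-- The residue form of (3.1) from the integer form. [folklore] -/
theorem K2_bound_zmod_of_int {c : ℕ} [NeZero c]
    (h : ∀ m₁ m₂ m₃ : ℤ, ‖K2 c (m₁ : ZMod c) (m₂ : ZMod c) (m₃ : ZMod c)‖ ≤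
      c * (Nat.gcd (Nat.gcd (Nat.gcd m₁.natAbs m₂.natAbs) m₃.natAbs) c : ℝ) * d3 c)
    (a₁ a₂ a₃ : ZMod c) :
    ‖K2 c a₁ a₂ a₃‖ ≤ c * (Nat.gcd (Nat.gcd (Nat.gcd a₁.val a₂.val) a₃.val) c : ℝ) * d3 c := by
  have := h (a₁.val : ℤ) (a₂.val : ℤ) (a₃.val : ℤ)
  rw [Int.cast_natCast, Int.cast_natCast, Int.cast_natCast, ZMod.natCast_zmod_val,
    ZMod.natCast_zmod_val, ZMod.natCast_zmod_val, Int.natAbs_natCast, Int.natAbs_natCast,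
    Int.natAbs_natCast] at this
  exact this

end HeathBrown1986

/-- **Lemma 4.13 at every level `θ < 1/2`, conditional on (3.1) at prime-power moduli only**
(`K2_bound_of_primePow` + `FouvryTenenbaum2021_lemma413_of_K2_bound`).
[cite: HeathBrown1986d3, §3 (3.1), (3.4) & p. 31] -/
theorem FouvryTenenbaum2021_lemma413_of_K2_bound_primePow
    (H : ∀ (c : ℕ) [NeZero c], (∃ p k : ℕ, p.Prime ∧ c = p ^ k) → ∀ m₁ m₂ m₃ : ℤ,
      ‖HeathBrown1986.K2 c (m₁ : ZMod c) (m₂ : ZMod c) (m₃ : ZMod c)‖ ≤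
        c * (Nat.gcd (Nat.gcd (Nat.gcd m₁.natAbs m₂.natAbs) m₃.natAbs) c : ℝ) * HeathBrown1986.d3 c)
    {θ : ℝ} (hθ : θ < 1 / 2) :
    ∃ δ C₀ C : ℝ, 0 < δ ∧ ∀ x : ℝ, 1 ≤ x → ∀ M₁ M₂ M₃ lo₁ hi₁ lo₂ hi₂ lo₃ hi₃ : ℝ,
      x ^ (1 / 100 : ℝ) ≤ M₁ → M₁ ≤ M₂ → M₂ ≤ M₃ → M₁ * M₂ * M₃ ≤ x →
      M₁ ≤ lo₁ → hi₁ ≤ 2 * M₁ → M₂ ≤ lo₂ → hi₂ ≤ 2 * M₂ → M₃ ≤ lo₃ → hi₃ ≤ 2 * M₃ →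
      ∀ (s D : ℕ) (a t₁ t₂ t₃ : ℤ), 1 ≤ s → (s : ℝ) ≤ x ^ θ → 1 ≤ D →
        IsCoprime (s : ℤ) (a * D) → IsCoprime (t₁ * t₂ * t₃) (D : ℤ) →
        |∑ m₁ ∈ (Ioc ⌊lo₁⌋₊ ⌊hi₁⌋₊).filter (fun m : ℕ => (m : ZMod D) = (t₁ : ZMod D)),
            ∑ m₂ ∈ (Ioc ⌊lo₂⌋₊ ⌊hi₂⌋₊).filter (fun m : ℕ => (m : ZMod D) = (t₂ : ZMod D)),
              ∑ m₃ ∈ (Ioc ⌊lo₃⌋₊ ⌊hi₃⌋₊).filter (fun m : ℕ => (m : ZMod D) = (t₃ : ZMod D)),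
                FouvryTenenbaum2021.gAP s a (m₁ * m₂ * m₃)| ≤
          C * (D : ℝ) ^ C₀ * x ^ (1 - δ) / (Nat.totient s : ℝ) :=
  FouvryTenenbaum2021_lemma413_of_K2_bound
    (fun q _ a₁ a₂ a₃ => HeathBrown1986.K2_bound_zmod_of_int
      (HeathBrown1986.K2_bound_of_primePow H q) a₁ a₂ a₃) hθ


/-! ## (3.1) at prime moduli: the degenerate cases -/

namespace HeathBrown1986

variable {p : ℕ} [Fact p.Prime]

/-- In `𝔽_p`, `IsUnit x ↔ x ≠ 0`. [folklore] -/
theorem isUnit_iff_ne_zero_prime (x : ZMod p) : IsUnit x ↔ x ≠ 0 := isUnit_iff_ne_zero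

/-- The Ramanujan sum at a prime: `∑_{x ≠ 0} e_p(ax) = p[a = 0] − 1`. [folklore] -/
theorem sum_ne_zero_stdAddChar (a : ZMod p) :
    ∑ x ∈ (Finset.univ : Finset (ZMod p)).erase 0, (ZMod.stdAddChar (a * x) : ℂ) =
      (if a = 0 then (p : ℂ) else 0) - 1 := by
  have h := sum_stdAddChar_mul p a
  rw [← Finset.sum_erase_add _ _ (Finset.mem_univ (0 : ZMod p)), mul_zero, AddChar.map_zero_eq_one] at h
  rw [← h]; ring

/-- `|p[a = 0] − 1| ≤ p − 1` and `= 1` for `a ≠ 0`. [folklore] -/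
theorem norm_ramanujan_prime_le (a : ZMod p) :
    ‖(if a = 0 then (p : ℂ) else 0) - 1‖ ≤ (p : ℝ) - 1 := by
  have hp : 2 ≤ p := (Fact.out : p.Prime).two_le
  have hpR : (2 : ℝ) ≤ p := by exact_mod_cast hp
  split_ifs
  · have : ((p : ℂ) - 1) = (((p : ℝ) - 1 : ℝ) : ℂ) := by push_cast; ring
    rw [this, Complex.norm_real, Real.norm_eq_abs, abs_of_nonneg (by linarith)]
  · rw [zero_sub, norm_neg, norm_one]; linarith

/-- `K₂(a₁, a₂, 0; p) = c_p(a₁) c_p(a₂)`. [folklore] -/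
theorem K2_third_zero (a₁ a₂ : ZMod p) :
    K2 p a₁ a₂ 0 = ((if a₁ = 0 then (p : ℂ) else 0) - 1) * ((if a₂ = 0 then (p : ℂ) else 0) - 1) := by
  classical
  unfold K2
  rw [← sum_ne_zero_stdAddChar, ← sum_ne_zero_stdAddChar, Finset.sum_mul_sum]
  rw [← Finset.sum_erase_add _ _ (Finset.mem_univ (0 : ZMod p))]
  have hx0 : ∑ y : ZMod p, (if IsUnit (0 : ZMod p) ∧ IsUnit y then
      (ZMod.stdAddChar (a₁ * 0 + a₂ * y + 0 * ((0 : ZMod p)⁻¹ * y⁻¹)) : ℂ) else 0) = 0 :=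
    Finset.sum_eq_zero fun y _ => by
      rw [if_neg (fun h => (isUnit_iff_ne_zero_prime (0 : ZMod p)).mp h.1 rfl)]
  rw [hx0, add_zero]
  refine Finset.sum_congr rfl fun x hx => ?_
  have hx0' : x ≠ 0 := Finset.ne_of_mem_erase hx
  rw [← Finset.sum_erase_add _ _ (Finset.mem_univ (0 : ZMod p)),
    if_neg (fun h => (isUnit_iff_ne_zero_prime (0 : ZMod p)).mp h.2 rfl), add_zero]
  refine Finset.sum_congr rfl fun y hy => ?_
  have hy0 : y ≠ 0 := Finset.ne_of_mem_erase hy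
  rw [if_pos ⟨(isUnit_iff_ne_zero_prime x).mpr hx0', (isUnit_iff_ne_zero_prime y).mpr hy0⟩,
    zero_mul, add_zero, AddChar.map_add_eq_mul]

/-- `K₂(0, a₂, a₃; p) = −c_p(a₂)` for `a₃ ≠ 0`. [folklore] -/
theorem K2_first_zero {a₂ a₃ : ZMod p} (ha₃ : a₃ ≠ 0) :
    K2 p 0 a₂ a₃ = -(((if a₂ = 0 then (p : ℂ) else 0) - 1)) := by
  classical
  unfold K2
  -- `∑_x ∑_y [x,y ≠ 0] ψ(a₂ y + a₃ x̄ ȳ) = ∑_{y ≠ 0} ψ(a₂ y) ∑_{x ≠ 0} ψ(a₃ ȳ x̄)`, inner sum `= -1`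
  have hinner : ∀ y : ZMod p, y ≠ 0 →
      ∑ x : ZMod p, (if IsUnit x ∧ IsUnit y then
        (ZMod.stdAddChar (0 * x + a₂ * y + a₃ * (x⁻¹ * y⁻¹)) : ℂ) else 0) =
        (ZMod.stdAddChar (a₂ * y) : ℂ) * (-1) := by
    intro y hy
    have hyu : IsUnit y := (isUnit_iff_ne_zero_prime y).mpr hy
    -- reindex `x ↦ x⁻¹` on the nonzero elements
    have e1 : ∑ x : ZMod p, (if IsUnit x ∧ IsUnit y then
        (ZMod.stdAddChar (0 * x + a₂ * y + a₃ * (x⁻¹ * y⁻¹)) : ℂ) else 0) =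
        ∑ x ∈ (Finset.univ : Finset (ZMod p)).erase 0,
          (ZMod.stdAddChar (a₂ * y) : ℂ) * (ZMod.stdAddChar ((a₃ * y⁻¹) * x⁻¹) : ℂ) := by
      rw [← Finset.sum_erase_add _ _ (Finset.mem_univ (0 : ZMod p))]
      rw [if_neg (fun h => (isUnit_iff_ne_zero_prime (0 : ZMod p)).mp h.1 rfl), add_zero]
      refine Finset.sum_congr rfl fun x hx => ?_
      have hx0 : x ≠ 0 := Finset.ne_of_mem_erase hx
      rw [if_pos ⟨(isUnit_iff_ne_zero_prime x).mpr hx0, hyu⟩, ← AddChar.map_add_eq_mul]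
      congr 1; ring
    have e2 : ∑ x ∈ (Finset.univ : Finset (ZMod p)).erase 0,
        (ZMod.stdAddChar (a₂ * y) : ℂ) * (ZMod.stdAddChar ((a₃ * y⁻¹) * x⁻¹) : ℂ) =
        (ZMod.stdAddChar (a₂ * y) : ℂ) *
          ∑ x ∈ (Finset.univ : Finset (ZMod p)).erase 0, (ZMod.stdAddChar ((a₃ * y⁻¹) * x) : ℂ) := by
      rw [Finset.mul_sum]
      refine Finset.sum_nbij' (fun x => x⁻¹) (fun x => x⁻¹) (fun x hx => ?_) (fun x hx => ?_)
        (fun x _ => inv_inv x) (fun x _ => inv_inv x) (fun x _ => rfl)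
      · rw [Finset.mem_erase] at hx ⊢; exact ⟨inv_ne_zero hx.1, Finset.mem_univ _⟩
      · rw [Finset.mem_erase] at hx ⊢; exact ⟨inv_ne_zero hx.1, Finset.mem_univ _⟩
    rw [e1, e2, sum_ne_zero_stdAddChar]
    have hc : a₃ * y⁻¹ ≠ 0 := mul_ne_zero ha₃ (inv_ne_zero hy)
    rw [if_neg hc, zero_sub]
  rw [Finset.sum_comm]
  rw [← Finset.sum_erase_add _ _ (Finset.mem_univ (0 : ZMod p))]
  have h0 : ∑ x : ZMod p, (if IsUnit x ∧ IsUnit (0 : ZMod p) then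
      (ZMod.stdAddChar (0 * x + a₂ * 0 + a₃ * (x⁻¹ * (0 : ZMod p)⁻¹)) : ℂ) else 0) = 0 :=
    Finset.sum_eq_zero fun x _ => by
      rw [if_neg (fun h => (isUnit_iff_ne_zero_prime (0 : ZMod p)).mp h.2 rfl)]
  rw [h0, add_zero, Finset.sum_congr rfl (fun y hy => hinner y (Finset.ne_of_mem_erase hy)),
    ← Finset.sum_mul, sum_ne_zero_stdAddChar]
  ring

/-- `K₂(a₁, 0, a₃; p) = −c_p(a₁)` for `a₃ ≠ 0` (symmetry `x ↔ y`). [folklore] -/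
theorem K2_second_zero {a₁ a₃ : ZMod p} (ha₃ : a₃ ≠ 0) :
    K2 p a₁ 0 a₃ = -(((if a₁ = 0 then (p : ℂ) else 0) - 1)) := by
  classical
  have hsymm : K2 p a₁ 0 a₃ = K2 p 0 a₁ a₃ := by
    unfold K2
    rw [Finset.sum_comm]
    refine Finset.sum_congr rfl fun y _ => Finset.sum_congr rfl fun x _ => ?_
    have : (IsUnit x ∧ IsUnit y) ↔ (IsUnit y ∧ IsUnit x) := and_comm
    simp only [this]
    split_ifs
    · congr 1; ring
    · rfl
  rw [hsymm, K2_first_zero ha₃]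

/-- `d₃(p) = 3`. [folklore] -/
theorem d3_prime : d3 p = 3 := by
  have hp : p.Prime := Fact.out
  unfold d3
  rw [hp.divisors, Finset.sum_insert (by simp [hp.ne_one.symm]), Finset.sum_singleton,
    Nat.divisors_one, Finset.card_singleton, hp.divisors, Finset.card_insert_of_notMem (by simp [hp.ne_one.symm]),
    Finset.card_singleton]

/-- **(3.1) at a prime from Deligne's nondegenerate bound.** If `|K₂(a; p)| ≤ 3p` whenever
`p ∤ a₁a₂a₃` (Deligne's estimate for `Kl₃`, as in Smith's Theorem 6), then
`|K₂(a; p)| ≤ p (a, p) d₃(p)` for all `a`: the degenerate sums are `c_p(a₁)c_p(a₂)` (`a₃ ≡ 0`) or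
`−c_p(aᵢ)` (`a₃ ≢ 0`, `a₁a₂ ≡ 0`), of modulus `≤ (p − 1)²` resp. `≤ p − 1`. [cite: HeathBrown1986d3, §3 (3.1), (3.6)–(3.8)] -/
theorem K2_bound_prime_of_nondegenerate
    (hD : ∀ a₁ a₂ a₃ : ZMod p, a₁ ≠ 0 → a₂ ≠ 0 → a₃ ≠ 0 → ‖K2 p a₁ a₂ a₃‖ ≤ 3 * p)
    (a₁ a₂ a₃ : ZMod p) :
    ‖K2 p a₁ a₂ a₃‖ ≤ p * (Nat.gcd (Nat.gcd (Nat.gcd a₁.val a₂.val) a₃.val) p : ℝ) * d3 p := by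
  have hp : p.Prime := Fact.out
  have hp2 : (2 : ℝ) ≤ p := by exact_mod_cast hp.two_le
  have hp0 : (0 : ℝ) < p := by linarith
  rw [d3_prime]
  push_cast
  set g : ℕ := Nat.gcd (Nat.gcd (Nat.gcd a₁.val a₂.val) a₃.val) p with hg
  have hg1 : (1 : ℝ) ≤ g := by exact_mod_cast Nat.gcd_pos_of_pos_right _ hp.pos
  -- the generic bound `3p ≤ p g 3`
  have h3p : 3 * (p : ℝ) ≤ p * g * 3 := by nlinarith
  have hpm1 : (p : ℝ) - 1 ≤ 3 * p := by linarith
  by_cases h₃ : a₃ = 0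
  · -- `c_p(a₁) c_p(a₂)`
    rw [h₃, K2_third_zero, norm_mul]
    by_cases h₁ : a₁ = 0
    · by_cases h₂ : a₂ = 0
      · -- all zero: `g = p`
        have hgp : g = p := by
          rw [hg, h₁, h₂, h₃, ZMod.val_zero, Nat.gcd_zero_left, Nat.gcd_zero_left, Nat.gcd_zero_left]
        rw [hgp]
        calc ‖(if a₁ = 0 then (p : ℂ) else 0) - 1‖ * ‖(if a₂ = 0 then (p : ℂ) else 0) - 1‖
            ≤ ((p : ℝ) - 1) * ((p : ℝ) - 1) :=
              mul_le_mul (norm_ramanujan_prime_le _) (norm_ramanujan_prime_le _) (norm_nonneg _) (by linarith)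
          _ ≤ p * p * 3 := by nlinarith
      · have e₂ : ‖(if a₂ = 0 then (p : ℂ) else 0) - 1‖ = 1 := by rw [if_neg h₂, zero_sub, norm_neg, norm_one]
        rw [e₂, mul_one]
        exact ((norm_ramanujan_prime_le _).trans hpm1).trans h3p
    · have e₁ : ‖(if a₁ = 0 then (p : ℂ) else 0) - 1‖ = 1 := by rw [if_neg h₁, zero_sub, norm_neg, norm_one]
      rw [e₁, one_mul]
      exact ((norm_ramanujan_prime_le _).trans hpm1).trans h3p
  · by_cases h₁ : a₁ = 0
    · rw [h₁, K2_first_zero h₃, norm_neg]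
      exact ((norm_ramanujan_prime_le _).trans hpm1).trans h3p
    · by_cases h₂ : a₂ = 0
      · rw [h₂, K2_second_zero h₃, norm_neg]
        exact ((norm_ramanujan_prime_le _).trans hpm1).trans h3p
      · exact (hD a₁ a₂ a₃ h₁ h₂ h₃).trans h3p

end HeathBrown1986


end Literature.NumberTheory.Sieve

end
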